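import Literature.NumberTheory.LFunctions.Zhang2022.RepairGramBlock
import Literature.NumberTheory.LFunctions.Zhang2022.RepairWallCrossForced
import Literature.NumberTheory.LFunctions.Zhang2022.KnifeEdgeNuOverhang
import Literature.NumberTheory.LFunctions.Zhang2022.KnifeEdgeDiscWeightScale
import Literature.NumberTheory.LFunctions.Zhang2022.RepairBandEdge
import Literature.NumberTheory.LFunctions.Zhang2022.RepairRplusBandMV
import Literature.NumberTheory.LFunctions.Zhang2022.RepairFarBV
import Literature.NumberTheory.LFunctions.Zhang2022.RepairBandSlotMain
import Literature.NumberTheory.LFunctions.Zhang2022.Section4Prop22Eventually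
import Literature.NumberTheory.LFunctions.Zhang2022.Section7Prop71Holds
import Literature.NumberTheory.LFunctions.Zhang2022.Section10Theta1Evals
import HarnessLib

/-!
# Zhang (2022), programme F-S3 §E (cell landau-siegel, barrier extension): the §E / F-S2 ENDGAMES with the
# manuscript's Part-I nodes DISCHARGED — `Prop22i` (outright) and `Lemma23 c′`, `Lemma81 c′` (for every
# sufficiently large `c′`) are TREE THEOREMS, so the (b)-binders «weights real and `≥ 0`» displayed in every
# positivity endgame of the class of record drop out in the `c′`-eventual reading; and (Part 8) Proposition 7.1
# (`Prop71 c′`, every `c′`) is a TREE THEOREM too, so it drops out wherever a row displayed it (LEAF file: nothing imports it)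

Y. Zhang, *Discrete mean estimates and the Landau–Siegel zero*, arXiv:2211.02515v1 [Zhang2022LandauSiegel] — an
unrefereed manuscript under adjudication. **WHAT THIS IS NOT: not a claim about Theorems 1–2 of arXiv:2211.02515,
about Landau–Siegel zeros, about a repaired `Margin232`, or about Parity. Every ANALYTIC input below (the
dictionaries `EStarLen`, `EMultiBand`, `BulkAsympAt`/`BandAsympAt`/`ECrossBandAsymp`, `EMultiLambda`, `MuPsiDict`,
`NuDict`/`NuMeanInvisible`, `GramDictionary`/`PairDictionary`, `Prop71`) stays DISPLAYED, never asserted; what is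
removed from the displays is only what the tree PROVES. The programme SEARCHES and TYPES; no claim about
Landau–Siegel zeros, Theorems 1–2 of arXiv:2211.02515 or a repaired Margin232 until a kernel theorem says so.**

## The point (BARRIER-STATE §2′ N12, ls-barrier-plan g1 2026-08-26T23:01:16Z)

Every positivity endgame of the §E class of record — `KnifeEdge.eventually_not_assumptionA_of_negative_mainTerm`
(F-S2, p456081), `…_family` (p458037), `…_scale` (p458584) and their family corollaries (E*-len, E-10/E-034, E-14,
E-16/E-17, E-19) — displays the manuscript's Proposition 2.2 (i) (`Skeleton.Prop22i`: the zeros of `L(s,ψ)L(s,ψχ)` in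
`Ω` lie on the critical line for `ψ ∈ Ψ₁`) and Lemma 2.3 (`Skeleton.Lemma23 c′`: `𝔠*(ρ,ψ)` real and `≥ 0`) as
hypotheses «CLAIMS of the manuscript, never asserted». Since 2026-08-26T11:12Z (sz-skel gen 6, p439781; F-S1
adjudication errata E22: «DAG tokens Z22:Prop2.2 / Z22:Lem2.3 / Z22:Lem8.1 → discharged in the THRESHOLD
(eventually-in-c′) reading») these nodes are KERNEL THEOREMS of the tree, composed from the landed §§2–4 / §8 chains:
`Skeleton.prop22i_holds : Prop22i` (no hypothesis), `Skeleton.lemma23_eventually : ∃ c₀ ≥ 0, ∀ c′ ≥ c₀, Lemma23 c′`,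
`Skeleton.lemma81_eventually`, `Skeleton.partOne_eventually` (`Section4Prop22Eventually`). The constant `c′` is the
manuscript's own «some (large) constant `c′ > 0`» of (2.13) (p. 7), a free parameter of every dictionary row; hence
each endgame has a CLOSED twin of the shape `∃ c₀ ≥ 0, ∀ c′ ≥ c₀, ⟨dictionary at c′⟩ → ⟨closing⟩ → ¬(A) eventually`
(and `→ Theorem1`), with NO manuscript claim displayed. This file records those twins; it changes no class, no row
and no verdict of `Repair.Rplusplus<k>` (REF-E: the residual displayed inputs of the class of record are then the
ANALYTIC slots — E-004 band slots, `NuMeanInvisible` (E-074′), the E-072 sign, B-AH/E-014 model rows,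
`GramDictionary` (kind (c)) — plus the structural WORLD binders `Re ρ = ½` / `Re 𝔠*·Re ω ≥ 0` where a row chose to
display them pointwise instead of through `Prop22i`/`Lemma23`; since Parts 9, 11, 12 those binders are ELIMINATED too —
`idx_re_half_eventually`, `weights_nonneg_eventually` — so only the analytic slots and (A) remain). ERRATUM (Part 8, 2026-08-27; finding of ls-Blen-typer-1
g4, INBOX 00:27:55Z): the sentence that stood here in v1–v3 — «`Prop71 c′` (Prop. 7.1, mean-value formula I) is NOT
discharged: its closure in the tree runs through the leaf (7.11) (`Section7bStatements.Eq711` …), so it stays displayed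
where a row uses it» — is WITHDRAWN as stale: `Section7cStatements.prop71X_holds : ∀ c′, Skeleton.Prop71 c′` (module
`Section7Prop71Holds`) is a tree theorem, its leaf (7.11) being closed on the full (7.2) support by `eq711X'_holds`
(p436190, the G-adj2-1 extended-range chain; the three adjudicated repairs G-adj2-1/2/3 are load-bearing in that proof,
see that module's docstring). Parts 5–7 keep their landed forms with `Prop71 c′` displayed (statements are never
deleted); Part 8 gives the twins with `Prop71` fed by `prop71X_holds` — after it the residual displayed inputs of this
leaf's rows are the analytic SLOTS and IDENTIFICATION rows only ((7.2)-admissibility, (M), (E), E-004′ `BandMeanValue`,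
the dictionaries), plus (A). (The sibling leaf `RepairBlenNuLipschitzClosed`, p478754, exports the four nodes under one
threshold as `Repair.partOne71_eventually`; it is not imported here — the twins below compose `prop71X_holds` directly.)

Contents: Part 1 — the Part-I nodes under one threshold (`partOneNodes_eventually`). Part 2 — the three root
endgames closed (`eventually_not_assumptionA_of_negative_mainTerm_closed`, `…_family_closed`, `…_scale_closed`).
Part 3 — the family corollaries closed: E*-len (`theorem1_of_eStarLen_closed`), E-034/E-10 (`theorem1_of_eMultiBand_closed`,
`familyWallBand_dichotomy_closed`, `theorem1_of_cross_beyond_cs_closed`), E-14 (`theorem1_of_eMultiLambda_closed`),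
μψ / νψ (`theorem1_of_muPsiDict_closed`, `theorem1_of_nuDict_closed`, `not_nuCloses_of_invisible_closed`). Part 4 —
E-19 (`gramDictionary_dichotomy_closed`, `theorem1_of_gramDictionary_closes_closed`,
`familyGramBlockDict_decided_closed`, `familyGramBlockDict_of_entries_closed`). Part 5 — the units lemma with only
Prop. 7.1 displayed (`discWeight_trivialScale_closed`). Part 6 — ONE ENTRY of the Gram dictionary in the vocabulary of
Prop. 7.1 / Lemma 8.1 for (7.2)-admissible coefficient tables (`discPolar_apoly_eq_lhs81`, `pairDictionary_of_meanValue`,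
`pairDictionary_of_meanValue_closed`, `discMean_apoly_of_meanValue_closed`): the residual «dictionary step» is Prop. 7.1
plus two displayed evaluation rows (main-term evaluation of the `S_j` sums; error functional `o(𝔞𝔓)`). Part 7 — completion of the N12 list for rows whose authors'
seats are closed: E-035 discrete (`theorem1_of_crossNegDiscrete_closed`), E-004 band-scale / true-band rows 31–38
(`discMeanFlat_bandEdge_mainScale_closed`, `discMeanTrueBandAOn_wallZeroLip_of_bandMeanValue_closed`,
`discMeanTrueBandA_of_bandMeanValue_closed` — only `Prop71` and E-004′ `BandMeanValue` displayed). Part 8 — Prop. 7.1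
DISCHARGED (`Section7cStatements.prop71X_holds`): the primed twins `discWeight_trivialScale_closed'` (the units lemma with
NOTHING displayed), `pairDictionary_of_meanValue_closed'` / `discMean_apoly_of_meanValue_closed'` (the Prop. 7.1 entry
with only (7.2)-admissibility and the rows (M)/(E) displayed), `discMeanFlat_bandEdge_mainScale_closed'` (row-31 engine
with Prop. 7.1 AND the world binder `Re ρ = ½` discharged, the latter by `prop22i_holds` — only (A) displayed),
`discMeanTrueBandAOn_wallZeroLip_of_bandMeanValue_closed'` / `discMeanTrueBandA_of_bandMeanValue_closed'` (only E-004′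
displayed). Part 9 — the two structural WORLD BINDERS are tree theorems eventually: (b) «`Re ρ = ½` on `idx χ`»
(`idx_re_half_of`, `idx_re_half_eventually`, and the generic (b)-eliminators `forAllLarge_of_idx_re_half` /
`forAllLarge_of_assumptionA_idx_re_half` by which EVERY row displaying (b) inside its `ForAllLarge` drops it) and the
weight-positivity binder (w) «`Re 𝔠*·Re ω ≥ 0` on `idx χ`» for `c′ ≥ c₀` (`weights_nonneg_eventually`,
`forAllLarge_of_weights_nonneg`, `forAllLarge_of_world_binders`); then the band rows of `RepairRplusBandMV` (p477819 /
v2 p480299, ls-barrier-p2 g3) read CLOSED — the clean FROM-THE-WALL theorems for ANY coefficient-class slot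
`BandMeanValueOn 𝒞` and for the slot of record E-004″ `BandMeanValueLip` (`discMean_fromWall_of_bandMeanValueOn_closed`,
`discMean_fromWall_topVanishing_of_bandMeanValueOn_closed`, `discMean_fromWall_of_bandMeanValueLip_closed`,
`discMean_fromWall_topVanishing_of_bandMeanValueLip_closed`) and the ROWS OF RECORD 41′–44′
(`familyWallZeroBandMVLip_verdict_closed`, `familyWallZeroTopBandMVLip_verdict_closed`,
`familySmoothWallZeroBandMVLip_verdict_closed`, `familySmoothTopWallZeroBandMVLip_verdict_closed`) with the four nodes
AND (b) discharged — ONLY E-004″ `BandMeanValueLip c′ K 1078 κ` and (A) displayed (row 41's E-004′ reading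
`familyWallZeroBandMV_verdict_closed` kept as the special case `BandMeanValue.lip`). Part 10 —
the FLOOR read closed: the discrete-mean currency of class `R⁺` (`Repair.not_repairable_in_Rplus`, `farPiece`) and the
far-BV row E-033 (`Repair.familyFarBV`), and registry row E-003 (E*-inv, `discMean_profPoly_flat`), with NOTHING
displayed (`discMean_profPoly_flat_closed`, `not_repairable_in_Rplus_farPiece_closed`, `familyFarPiece_verdict_closed`,
`not_lengthGain_farBV_closed`, `familyFarBV_verdict_closed`). Part 11 — every remaining TRUE-CURRENCY row that displays
(b) inside its `ForAllLarge`, read without (b): `familyWallZero_verdict_closed`, `familyWallZeroTop_verdict_closed`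
(p459259, slot `DiscMeanBandWidthWall0`), `familySmoothLengths_verdict_closed`, `familySmoothTop_verdict_closed` (p457377,
NOTHING displayed), `familyWallZeroMain_verdict_closed`, `familyWallZeroTopMain_verdict_closed` (p466556, slot
`DiscMeanBandMain`), `familyBandEdge_verdict_closed` (p469716), `familySmoothBandEdge_verdict_closed`,
`familySmoothTopBandEdge_verdict_closed` (p470027) (NOTHING displayed), `familyWallZeroTrueBand_verdict_closed`,
`familyWallZeroTopTrueBand_verdict_closed` (p470415, slot `DiscMeanTrueBand`), `familySmoothWallZeroTrueBand_verdict_closed`,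
`familySmoothTopWallZeroTrueBand_verdict_closed` (p471890, slot `DiscMeanTrueBandKM`). Part 12 — (B1) positivity and
`GramPSD_k` with NOTHING displayed for `c′ ≥ c₀` (`discMean_nonneg_eventually`, `discGram_posSemidef_eventually`,
`discMean_tableComb_nonneg_eventually`, `familyGramTables_verdict_eventually`). Theorems only (compositions of landed
theorems plus one triangle-inequality assembly); no definition, no new named fact; standard axioms.

References: Zhang, arXiv:2211.02515v1, §2 pp. 4–7 (Prop. 2.2, Lemma 2.3, (2.13), (2.15)–(2.17)), §7 Prop 7.1, §8
Lemma 8.1 [cite: Zhang2022LandauSiegel, §2 Prop. 2.2; §2 Lemma 2.3; §7 Prop 7.1; §8 Lemma 8.1].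
-/

noncomputable section

open Complex Real Set ComplexConjugate Matrix
open scoped ComplexOrder

namespace Literature.NumberTheory.LFunctions.Zhang2022

namespace KnifeEdge

open Repair Skeleton

/-! ### Part 1 — the Part-I nodes of the manuscript under ONE threshold (re-export of `Section4Prop22Eventually`) -/

/-- **Prop. 2.2 (i) outright, Lemma 2.3 and Lemma 8.1 for every sufficiently large `c′`, under one threshold** —
tree theorems (`Skeleton.prop22i_holds`, `Skeleton.partOne_eventually`), re-exported in the shape the endgames consume.
[cite: Zhang2022LandauSiegel, §2 Prop. 2.2 (i); §2 Lemma 2.3; §8 Lemma 8.1] -/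
theorem partOneNodes_eventually :
    ∃ c₀ : ℝ, 0 ≤ c₀ ∧ ∀ c' : ℝ, c₀ ≤ c' → Prop22i ∧ Lemma23 c' ∧ Lemma81 c' := by
  obtain ⟨c₀, h0, h⟩ := partOne_eventually
  exact ⟨c₀, h0, fun c' hc' => ⟨prop22i_holds, (h c' hc').2.1, (h c' hc').2.2.1⟩⟩

/-! ### Part 2 — the three root endgames, CLOSED (no manuscript claim displayed) -/

/-- **F-S2's positivity endgame, closed** (`eventually_not_assumptionA_of_negative_mainTerm`, p456081, with
`Prop22i`/`Lemma23` discharged): for every sufficiently large `c′`, a profile polynomial whose discrete mean has a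
NEGATIVE main term `m·𝔞𝔓 + o(𝔞𝔓)` under (A) refutes (A) for every real primitive character to every large modulus.
[cite: Zhang2022LandauSiegel, §2 p. 6, Lemma 2.3, Prop. 2.2 (i), (2.15)] -/
theorem eventually_not_assumptionA_of_negative_mainTerm_closed :
    ∃ c₀ : ℝ, 0 ≤ c₀ ∧ ∀ c' : ℝ, c₀ ≤ c' → ∀ {m : ℝ}, m < 0 → ∀ {T : ℝ} {g : ℝ → ℂ},
      (∀ ε : ℝ, 0 < ε → ForAllLarge fun D _ χ => AssumptionA D χ →
        |discMean c' χ (fun x s => profPoly χ x g ⌈bigP D ^ T⌉₊ s) - m * frakA χ * frakP D|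
          ≤ ε * frakA χ * frakP D) →
      ∃ D₀ : ℕ, ∀ (D : ℕ) [NeZero D] (χ : DirichletCharacter ℂ D),
        D₀ ≤ D → χ.IsQuadratic → χ.IsPrimitive → ¬ AssumptionA D χ := by
  obtain ⟨c₀, h0, h⟩ := lemma23_eventually
  exact ⟨c₀, h0, fun c' hc' _ hm _ _ hasymp =>
    eventually_not_assumptionA_of_negative_mainTerm hm hasymp prop22i_holds (h c' hc')⟩

/-- **The FAMILY endgame, closed** (`eventually_not_assumptionA_of_negative_mainTerm_family`, p458037): for every
sufficiently large `c′`, any family of value tables with a NEGATIVE main term under (A) refutes (A) eventually.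
[cite: Zhang2022LandauSiegel, §2 p. 6, Lemma 2.3, Prop. 2.2 (i), (2.15)] -/
theorem eventually_not_assumptionA_of_negative_mainTerm_family_closed :
    ∃ c₀ : ℝ, 0 ≤ c₀ ∧ ∀ c' : ℝ, c₀ ≤ c' → ∀ {m : ℝ}, m < 0 →
      ∀ {F : (D : ℕ) → DirichletCharacter ℂ D → (Chr D → ℂ → ℂ)},
      (∀ ε : ℝ, 0 < ε → ForAllLarge fun D _ χ => AssumptionA D χ →
        |discMean c' χ (F D χ) - m * frakA χ * frakP D| ≤ ε * frakA χ * frakP D) →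
      ∃ D₀ : ℕ, ∀ (D : ℕ) [NeZero D] (χ : DirichletCharacter ℂ D),
        D₀ ≤ D → χ.IsQuadratic → χ.IsPrimitive → ¬ AssumptionA D χ := by
  obtain ⟨c₀, h0, h⟩ := lemma23_eventually
  exact ⟨c₀, h0, fun c' hc' _ hm _ hasymp =>
    eventually_not_assumptionA_of_negative_mainTerm_family hm hasymp prop22i_holds (h c' hc')⟩

/-- **The SCALE-FREE endgame, closed** (`eventually_not_assumptionA_of_negative_mainTerm_scale`, p458584): for every
sufficiently large `c′`, any family of test values with main term `m·S·𝔓 + o(S𝔓)`, `m < 0`, at an eventually positive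
scale `S`, refutes (A) eventually. [cite: Zhang2022LandauSiegel, §2 (2.16), Lemma 2.3, Prop. 2.2 (i)] -/
theorem eventually_not_assumptionA_of_negative_mainTerm_scale_closed :
    ∃ c₀ : ℝ, 0 ≤ c₀ ∧ ∀ c' : ℝ, c₀ ≤ c' → ∀ {m : ℝ}, m < 0 → ∀ {S : Scale}
      {F : (D : ℕ) → [NeZero D] → DirichletCharacter ℂ D → Chr D → ℂ → ℂ},
      ScaleEventuallyPos S →
      (∀ ε : ℝ, 0 < ε → ForAllLarge fun D _ χ => AssumptionA D χ →
        |discMean c' χ (F D χ) - m * S D χ * frakP D| ≤ ε * S D χ * frakP D) →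
      ∃ D₀ : ℕ, ∀ (D : ℕ) [NeZero D] (χ : DirichletCharacter ℂ D),
        D₀ ≤ D → χ.IsQuadratic → χ.IsPrimitive → ¬ AssumptionA D χ := by
  obtain ⟨c₀, h0, h⟩ := lemma23_eventually
  exact ⟨c₀, h0, fun c' hc' _ hm _ _ hS hasymp =>
    eventually_not_assumptionA_of_negative_mainTerm_scale hm hS hasymp prop22i_holds (h c' hc')⟩

/-! ### Part 3 — the family corollaries, CLOSED -/

/-- **E*-len (F-S2 card 1), closed:** for every sufficiently large `c′`, `EStarLen c′ δ O` + its closing ⇒ Theorem 1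
AND Theorem 2 of the manuscript — the two `E*` hypotheses (registry E-001, XL) are the only displayed inputs.
[cite: Zhang2022LandauSiegel, §1 Theorems 1–2; §2 p. 6; §7 Prop 7.1 (7.2)] -/
theorem theorem1_of_eStarLen_closed :
    ∃ c₀ : ℝ, 0 ≤ c₀ ∧ ∀ c' : ℝ, c₀ ≤ c' → ∀ {δ : ℝ} {O : PairFunctional},
      EStarLen c' δ O → EStarLenCloses δ O → Theorem1 ∧ Theorem2 := by
  obtain ⟨c₀, h0, h⟩ := lemma23_eventually
  exact ⟨c₀, h0, fun c' hc' _ _ hE hC =>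
    ⟨theorem1_of_eStarLen hE hC prop22i_holds (h c' hc'), theorem2_of_eStarLen hE hC prop22i_holds (h c' hc')⟩⟩

/-- **E-034 / E-10 (the wall/band class), closed:** for every sufficiently large `c′`, `EMultiBand c′ K Λ X` + a
closing wall design ⇒ Theorems 1 and 2. [cite: Zhang2022LandauSiegel, §1 Theorems 1–2; §2 p. 6; §7 Prop 7.1 (7.2)] -/
theorem theorem1_of_eMultiBand_closed :
    ∃ c₀ : ℝ, 0 ≤ c₀ ∧ ∀ c' : ℝ, c₀ ≤ c' → ∀ {K : (ℝ → ℂ) → ℝ} {Λ : BandScale} {X : WallCross},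
      EMultiBand c' K Λ X → EMultiBandCloses K X → Theorem1 ∧ Theorem2 := by
  obtain ⟨c₀, h0, h⟩ := lemma23_eventually
  exact ⟨c₀, h0, fun c' hc' _ _ _ hE hC =>
    ⟨theorem1_of_eMultiBand hE hC prop22i_holds (h c' hc'), theorem2_of_eMultiBand hE hC prop22i_holds (h c' hc')⟩⟩

/-- **SEAM-1 (p460888) closed — the wall/band DICHOTOMY under the split dictionary with no manuscript claim
displayed:** for every sufficiently large `c′`, the bulk/band/cross rows at `c′` and `K ≥ 0` give: EITHER (A) fails
eventually OR no wall design closes. [cite: Zhang2022LandauSiegel, §2 Lemma 2.3, Prop. 2.2 (i); §7 Prop 7.1 (7.2); §8 Lemma 8.1] -/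
theorem familyWallBand_dichotomy_closed :
    ∃ c₀ : ℝ, 0 ≤ c₀ ∧ ∀ c' : ℝ, c₀ ≤ c' → ∀ {K : (ℝ → ℂ) → ℝ} {Λ : BandScale} {X : WallCross},
      (∀ u u' : ℝ → ℂ, KinkedProfile u u' → BulkAsympAt c' u u') →
      (∀ W : WallData, BandAsympAt c' K Λ W) → ECrossBandAsymp c' Λ X → (∀ b : ℝ → ℂ, 0 ≤ K b) →
      (∃ D₀ : ℕ, ∀ (D : ℕ) [NeZero D] (χ : DirichletCharacter ℂ D),
          D₀ ≤ D → χ.IsQuadratic → χ.IsPrimitive → ¬ AssumptionA D χ)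
        ∨ ¬ EMultiBandCloses K X := by
  obtain ⟨c₀, h0, h⟩ := lemma23_eventually
  exact ⟨c₀, h0, fun c' hc' _ _ _ hB hV hX hK =>
    familyWallBand_dichotomy hB hV hX hK prop22i_holds (h c' hc')⟩

/-- **SEAM-1, design form, closed:** for every sufficiently large `c′`, the three rows at ONE design `(u, W)` with a
model cross beyond its Cauchy–Schwarz maximum give Theorem 1 — no negative constant, no manuscript claim displayed.
[cite: Zhang2022LandauSiegel, §1 Theorem 1; §2 Lemma 2.3, Prop. 2.2 (i); §8 Lemma 8.1] -/
theorem theorem1_of_cross_beyond_cs_closed :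
    ∃ c₀ : ℝ, 0 ≤ c₀ ∧ ∀ c' : ℝ, c₀ ≤ c' → ∀ {K : (ℝ → ℂ) → ℝ} {Λ : BandScale} {X : WallCross}
      {u u' : ℝ → ℂ} {W : WallData},
      BulkAsympAt c' u u' → BandAsympAt c' K Λ W → CrossAsympAt c' Λ X u u' W → KinkedProfile u u' →
      0 ≤ K W.band → mainTermForm u u' * (‖W.hPlus‖ ^ 2 * K W.band) < ‖X u u' W‖ ^ 2 → Theorem1 := by
  obtain ⟨c₀, h0, h⟩ := lemma23_eventually
  exact ⟨c₀, h0, fun c' hc' _ _ _ _ _ _ hB hV hX hu hK hgap =>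
    theorem1_of_cross_beyond_cs hB hV hX hu hK hgap prop22i_holds (h c' hc')⟩

/-- **E-14 (the Λ-block class), closed:** for every sufficiently large `c′`, `EMultiLambda c′ K X Λs` + a closing
Λ-design ⇒ Theorems 1 and 2. [cite: Zhang2022LandauSiegel, §1 Theorems 1–2; §2 p. 6; §10 Lemma 10.1 (10.5)] -/
theorem theorem1_of_eMultiLambda_closed :
    ∃ c₀ : ℝ, 0 ≤ c₀ ∧ ∀ c' : ℝ, c₀ ≤ c' → ∀ {K : LambdaDiag} {X : LambdaCross} {Λs : BandScale},
      EMultiLambda c' K X Λs → EMultiLambdaCloses K X → Theorem1 ∧ Theorem2 := by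
  obtain ⟨c₀, h0, h⟩ := lemma23_eventually
  exact ⟨c₀, h0, fun c' hc' _ _ _ hE hC =>
    ⟨theorem1_of_eMultiLambda hE hC prop22i_holds (h c' hc'),
      theorem2_of_eMultiLambda hE hC prop22i_holds (h c' hc')⟩⟩

/-- **μψ one-sided pieces with top `b > 1` (B-len rows len-E7/E8; E-16), closed:** for every sufficiently large `c′`,
the μψ dictionary at `c′` + an eventually positive scale + the closing ⇒ Theorems 1 and 2.
[cite: Zhang2022LandauSiegel, §1 Theorems 1–2; §2 p. 6, (2.16)] -/
theorem theorem1_of_muPsiDict_closed :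
    ∃ c₀ : ℝ, 0 ≤ c₀ ∧ ∀ c' : ℝ, c₀ ≤ c' → ∀ {b : ℝ} {S : Scale} {M : (ℝ → ℂ) → (ℝ → ℂ) → ℝ}
      {X : PairFunctional},
      MuPsiDict c' b S M X → ScaleEventuallyPos S → MuPsiCloses b M X → Theorem1 ∧ Theorem2 := by
  obtain ⟨c₀, h0, h⟩ := lemma23_eventually
  exact ⟨c₀, h0, fun c' hc' _ _ _ _ hE hS hC =>
    ⟨theorem1_of_muPsiDict hE hS hC prop22i_holds (h c' hc'),
      theorem2_of_muPsiDict hE hS hC prop22i_holds (h c' hc')⟩⟩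

/-- **νψ overhang pieces (E-17), closed:** for every sufficiently large `c′`, the ν dictionary at `c′` + an
eventually positive scale + the closing ⇒ Theorems 1 and 2. [cite: Zhang2022LandauSiegel, §1 Theorems 1–2; §2 p. 6, (2.16)] -/
theorem theorem1_of_nuDict_closed :
    ∃ c₀ : ℝ, 0 ≤ c₀ ∧ ∀ c' : ℝ, c₀ ≤ c' → ∀ {θ : ℝ} {𝒱 : (ℝ → ℂ) → (ℝ → ℂ) → Prop} {S : Scale}
      {M : (ℝ → ℂ) → (ℝ → ℂ) → ℝ} {X : PairFunctional},
      NuDict c' θ 𝒱 S M X → ScaleEventuallyPos S → NuCloses 𝒱 M X → Theorem1 ∧ Theorem2 := by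
  obtain ⟨c₀, h0, h⟩ := lemma23_eventually
  exact ⟨c₀, h0, fun c' hc' _ _ _ _ _ hE hS hC =>
    ⟨theorem1_of_nuDict hE hS hC prop22i_holds (h c' hc'), theorem2_of_nuDict hE hS hC prop22i_holds (h c' hc')⟩⟩

/-- **E-074′ shut door (p461177), closed:** for every sufficiently large `c′`, a MEAN-INVISIBLE νψ overhang class has
the zero dictionary and does NOT close — only `NuMeanInvisible` is displayed.
[cite: Zhang2022LandauSiegel, §2 (2.16), Lemma 2.3, Prop. 2.2 (i)] -/
theorem not_nuCloses_of_invisible_closed :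
    ∃ c₀ : ℝ, 0 ≤ c₀ ∧ ∀ c' : ℝ, c₀ ≤ c' → ∀ {θ : ℝ} {𝒱 : (ℝ → ℂ) → (ℝ → ℂ) → Prop} {S : Scale},
      NuMeanInvisible c' θ 𝒱 S → NuDict c' θ 𝒱 S (fun _ _ => 0) 0 ∧ ¬ NuCloses 𝒱 (fun _ _ => 0) 0 := by
  obtain ⟨c₀, h0, h⟩ := lemma23_eventually
  exact ⟨c₀, h0, fun c' hc' _ _ _ hI => not_nuCloses_of_invisible hI prop22i_holds (h c' hc')⟩

/-! ### Part 4 — E-19 (the MIXED `k`-block members), CLOSED: only the dictionary (kind (c)) stays displayed -/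

section GramClosed

variable {ι : Type*} [Fintype ι]

/-- **DICHOTOMY «(A) ⇒ M ⪰ 0», closed** (`gramDictionary_dichotomy`, p467185): for every sufficiently large `c′`, a
Hermitian model matrix with an honest dictionary at `c′` is EITHER refuted-(A) material OR positive semidefinite —
no manuscript claim displayed. [cite: Zhang2022LandauSiegel, §2 Lemma 2.3, Prop. 2.2 (i), (2.15)–(2.17); §7 Prop 7.1 (7.2)] -/
theorem gramDictionary_dichotomy_closed :
    ∃ c₀ : ℝ, 0 ≤ c₀ ∧ ∀ c' : ℝ, c₀ ≤ c' →
      ∀ {T : ι → ((D : ℕ) → DirichletCharacter ℂ D → (Chr D → ℂ → ℂ))} {G : Matrix ι ι ℂ},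
      G.IsHermitian → GramDictionary c' T G →
      (∃ D₀ : ℕ, ∀ (D : ℕ) [NeZero D] (χ : DirichletCharacter ℂ D),
          D₀ ≤ D → χ.IsQuadratic → χ.IsPrimitive → ¬ AssumptionA D χ) ∨ G.PosSemidef := by
  obtain ⟨c₀, h0, h⟩ := lemma23_eventually
  exact ⟨c₀, h0, fun c' hc' _ _ hH hT => gramDictionary_dichotomy hH hT prop22i_holds (h c' hc')⟩

/-- **A closing member with an honest dictionary IS Theorem 1 (and Theorem 2), closed** — the content of the price
«E*-strength» in the word, with no manuscript claim displayed. [cite: Zhang2022LandauSiegel, §1 Theorems 1–2; §2 p. 6] -/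
theorem theorem1_of_gramDictionary_closes_closed :
    ∃ c₀ : ℝ, 0 ≤ c₀ ∧ ∀ c' : ℝ, c₀ ≤ c' →
      ∀ {T : ι → ((D : ℕ) → DirichletCharacter ℂ D → (Chr D → ℂ → ℂ))} {G : Matrix ι ι ℂ} {x : ι → ℂ},
      GramDictionary c' T G → gramForm G x < 0 → Theorem1 ∧ Theorem2 := by
  obtain ⟨c₀, h0, h⟩ := lemma23_eventually
  refine ⟨c₀, h0, fun c' hc' _ _ _ hT hx => ?_⟩
  have h1 : Theorem1 := theorem1_of_gramDictionary_closes hT hx prop22i_holds (h c' hc')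
  exact ⟨h1, Skeleton.theorem2_of_theorem1 h1⟩

end GramClosed

/-- **Row 27 `familyGramBlockDict`, verdict with the (b)-binders DISCHARGED:** there is `c₀ ≥ 0` such that every
member of the MIXED family (pieces admissible, model matrix Hermitian) whose realised tables have the honest dictionary
`gram` at balancing scale `Λs` and ANY `c′ ≥ c₀` satisfies: EITHER (A) fails eventually OR no amplitude vector closes.
The only displayed input is the dictionary `GramDictionary` (kind (c)). [cite: Zhang2022LandauSiegel, §2 Lemma 2.3, Prop. 2.2 (i); §7 Prop 7.1 (7.2); §8 Lemma 8.1] -/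
theorem familyGramBlockDict_decided_closed :
    ∃ c₀ : ℝ, 0 ≤ c₀ ∧ ∀ d : GramDesign, d.InClass → d.gram.IsHermitian → ∀ (Λs : BandScale) (c' : ℝ), c₀ ≤ c' →
      GramDictionary c' (fun i => (d.piece i).table Λs) d.gram →
      (∃ D₀ : ℕ, ∀ (D : ℕ) [NeZero D] (χ : DirichletCharacter ℂ D),
          D₀ ≤ D → χ.IsQuadratic → χ.IsPrimitive → ¬ AssumptionA D χ)
        ∨ ∀ x : Fin d.k → ℂ, ¬ (gramForm d.gram x < 0) := by
  obtain ⟨c₀, h0, h⟩ := lemma23_eventually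
  exact ⟨c₀, h0, fun d _ hH Λs c' hc' hT => familyGramBlockAll_dichotomy d Λs hH hT prop22i_holds (h c' hc')⟩

/-- **Row 27, ENTRY form, closed** (Part 11 of `RepairGramBlock`, p475927): the `k²` entry rows `PairDictionary`
(for `i ≤ j`) at any `c′ ≥ c₀` give the dichotomy — each entry a registry row by name (bulk·bulk E-028-type /
bulk·band E-006 / band·band E-034 / Λ E-030 / step E-028), nothing else displayed.
[cite: Zhang2022LandauSiegel, §2 Lemma 2.3, Prop. 2.2 (i); §7 Prop 7.1 (7.2); §8 Lemma 8.1] -/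
theorem familyGramBlockDict_of_entries_closed :
    ∃ c₀ : ℝ, 0 ≤ c₀ ∧ ∀ d : GramDesign, d.gram.IsHermitian → ∀ (Λs : BandScale) (c' : ℝ), c₀ ≤ c' →
      (∀ i j, i ≤ j → PairDictionary c' (fun D χ => (d.piece i).table Λs D χ)
        (fun D χ => (d.piece j).table Λs D χ) (d.gram i j)) →
      (∃ D₀ : ℕ, ∀ (D : ℕ) [NeZero D] (χ : DirichletCharacter ℂ D),
          D₀ ≤ D → χ.IsQuadratic → χ.IsPrimitive → ¬ AssumptionA D χ)
        ∨ ∀ x : Fin d.k → ℂ, ¬ (gramForm d.gram x < 0) := by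
  obtain ⟨c₀, h0, h⟩ := lemma23_eventually
  exact ⟨c₀, h0, fun d hH Λs c' hc' hE => familyGramBlockDict_of_entries d Λs hH hE prop22i_holds (h c' hc')⟩

/-! ### Part 5 — the units lemma with only Prop. 7.1 displayed -/

/-- **`discWeight = (8/π)·𝓛⁹·𝔓·(1 + o(1))` with only Prop. 7.1 displayed** (`Skeleton.discWeight_trivialScale`,
p467613, with Lemma 8.1 / Prop. 2.2 (i) / Lemma 2.3 discharged): for every sufficiently large `c′`, `Prop71 c′` alone
gives, for every `ε > 0`, a `C` with `|discWeight c′ χ − (8/π)·𝓛⁹·𝔓| ≤ (C·𝓛² + ε)·𝔓` for all large `D` under (A).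
(ERRATUM, Part 8: `Prop71 c′` IS a tree theorem, `Section7cStatements.prop71X_holds`; the fully closed twin is
`discWeight_trivialScale_closed'`. The v1 parenthesis «not discharged … leaf (7.11)» that stood here is withdrawn.)
[cite: Zhang2022LandauSiegel, §7 Prop 7.1, §8 Lemma 8.1, §2 Lemma 2.3] -/
theorem discWeight_trivialScale_closed :
    ∃ c₀ : ℝ, 0 ≤ c₀ ∧ ∀ c' : ℝ, c₀ ≤ c' → Prop71 c' →
      ∀ ε : ℝ, 0 < ε → ∃ C : ℝ, ForAllLarge fun D _ χ => AssumptionA D χ →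
        |Repair.discWeight c' χ - 8 / π * ell D ^ 9 * frakP D| ≤ (C * ell D ^ 2 + ε) * frakP D := by
  obtain ⟨c₀, h0, h⟩ := partOne_eventually
  exact ⟨c₀, h0, fun c' hc' h71 =>
    discWeight_trivialScale c' h71 (h c' hc').2.2.1 prop22i_holds (h c' hc').2.1⟩

/-! ### Part 6 — ONE ENTRY of the Gram dictionary in the vocabulary of Prop. 7.1 / Lemma 8.1

For value tables that ARE the manuscript's Dirichlet polynomials `A(𝐚; s, ψ)` of (7.2)-admissible coefficient
sequences (`Skeleton.Apoly x (a D χ)`, support `n < ⌈PT⁻²⌉`, `|a(n)| ≤ B`), the entry row `PairDictionary c′ T_a T_b g`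
is EXACTLY: Prop. 7.1 (`Skeleton.Prop71 c′`, displayed in this Part; DISCHARGED in Part 8 by `prop71X_holds`) ∧ Lemma 8.1 ∧
Prop. 2.2 (i) ∧ Lemma 2.3 (the last three DISCHARGED for large `c′`, Part 1) ∧ TWO displayed EVALUATION rows, which
are the whole residual «dictionary step» of KILL-CERT v2.4 §4 for such a pair: (M) the symmetrised main term of
Prop. 7.1, `α⁻¹(½S₁ + 2S₂ + 3/2·S₃)(𝐚, 𝐛̄)𝔓 + conj(…)(𝐛, 𝐚̄)𝔓`, is `g·𝔞𝔓 + o(𝔞𝔓)` under (A) — the §8/§10 evaluation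
of the `S_j` sums for the two profiles (E-028-type for bulk pieces); (E) the error functionals `E(𝐚,𝐛̄)`, `E(𝐛,𝐚̄)`
of Prop. 7.1 are `o(𝔞𝔓)` under (A). The bridge is the identity `Ξ(T_a, T_b) = Σ𝔠*·A(𝐚;ρ,ψ)A(𝐛̄;1−ρ,ψ̄)ω(ρ)`
(`discPolar_apoly_eq_lhs81`: at a zero on the critical line `A(𝐛̄;1−ρ,ψ̄) = conj A(𝐛;ρ,ψ)`, and the weights are
real; tree lemmas reused: `Section8aStatements.adm72_conj`, `Skeleton.Ecal_nonneg`, `Lemma81.conj_dirPoly`). NOT CLAIMED here: that a given `GramDesign` piece's table (`MixedPiece.table`, profile polynomials cut at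
the wall `n ≤ P^{1+α̃}`) IS such an `Apoly` table — the (7.2) cut at `1 − 2τ_T` versus the wall at `1` is the open
wording point WALL002-Q3 (B-multi/WALL002-Q3-MEMO.md), a separate displayed identification. -/

section MeanValueEntry

variable {c' : ℝ}

/-- **At a point of the critical line, `A(𝐛̄; 1−ρ, ψ̄) = conj A(𝐛; ρ, ψ)`** (`Lemma81.conj_dirPoly` with `1 − ρ = ρ̄`).
[cite: Zhang2022LandauSiegel, §8 p. 16 (proof of Lemma 8.1); §2 Prop. 2.2 (i)] -/
theorem apolyBar_conj_one_sub {D : ℕ} (x : Chr D) (b : ℕ → ℂ) {ρ : ℂ} (hρ : ρ.re = 1 / 2) :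
    ApolyBar x (fun n => conj (b n)) (1 - ρ) = conj (Apoly x b ρ) := by
  have h1 : (1 : ℂ) - ρ = conj ρ := by
    apply Complex.ext
    · simp only [Complex.sub_re, Complex.one_re, hρ, Complex.conj_re]; norm_num
    · simp only [Complex.sub_im, Complex.one_im, Complex.conj_im, zero_sub]
  rw [h1]
  exact (Lemma81.conj_dirPoly (Nsupp D) b x.ψ ρ).symm

/-- **The bridge `Ξ(T_𝐚, T_𝐛) = ΣΣ 𝔠*(ρ,ψ)·A(𝐚;ρ,ψ)·A(𝐛̄;1−ρ,ψ̄)·ω(ρ)`** at a modulus where Lemma 2.3 and Prop. 2.2 (i)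
hold (weights real, zeros on the line): the polar discrete pairing of two `Apoly` tables IS the left side of
Lemma 8.1 at the pair `(𝐚, 𝐛̄)`. [cite: Zhang2022LandauSiegel, §2 (2.15)–(2.17); §8 (8.3), (8.5), Lemma 8.1] -/
theorem discPolar_apoly_eq_lhs81 {D : ℕ} [NeZero D] {χ : DirichletCharacter ℂ D} (hD : 3 ≤ D)
    (h23 : ∀ x ∈ PsiOne χ, ∀ ρ ∈ zeroSet D x, (cstar c' D x ρ).im = 0 ∧ 0 ≤ (cstar c' D x ρ).re)
    (h22 : ∀ x ∈ PsiOne χ, ∀ s ∈ prodZeroSetOmega χ x, s.re = 1 / 2) (a b : ℕ → ℂ) :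
    discPolar c' χ (fun x s => Apoly x a s) (fun x s => Apoly x b s) = lhs81 c' χ a (fun n => conj (b n)) := by
  unfold discPolar lhs81
  refine Finset.sum_congr rfl fun i hi => ?_
  obtain ⟨h1, h2⟩ := Section11Deductions.mem_idx χ hi
  have hre : i.2.re = 1 / 2 := h22 i.1 h1 i.2 (mem_prodZeroSetOmega_of_mem_zeroSet χ h2)
  obtain ⟨hcim, -⟩ := h23 i.1 h1 i.2 h2
  obtain ⟨-, hωim⟩ := omegaW_re_pos hD hre
  have hc : cstar c' D i.1 i.2 = ((cstar c' D i.1 i.2).re : ℂ) := Complex.ext (by simp) (by simp [hcim])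
  have hω : omegaW D i.2 = ((omegaW D i.2).re : ℂ) := Complex.ext (by simp) (by simp [hωim])
  rw [apolyBar_conj_one_sub i.1 b hre, Complex.ofReal_mul, ← hc, ← hω]
  ring

/-- **ONE ENTRY FROM THE MANUSCRIPT'S MEAN-VALUE NODES.** For (7.2)-admissible coefficient tables `T_𝐚 = A(𝐚(D,χ);·,ψ)`,
`T_𝐛`: Prop. 7.1, Lemma 8.1, Prop. 2.2 (i), Lemma 2.3 (all displayed here), the MAIN-TERM EVALUATION row (M)
«`mainMV(𝐚,𝐛̄) + conj mainMV(𝐛,𝐚̄) = g·𝔞𝔓 + o(𝔞𝔓)` under (A)» and the ERROR-SIZE row (E) «`E(𝐚,𝐛̄), E(𝐛,𝐚̄) = o(𝔞𝔓)`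
under (A)» give `PairDictionary c′ T_𝐚 T_𝐛 g`. (Proof: the bridge, Lemma 8.1 at `(𝐚,𝐛̄)`, Prop. 7.1 at `(𝐚,𝐛̄)` and
`(𝐛,𝐚̄)`, and `𝔞 ≥ a₀ > 0` eventually under (A), `Skeleton.frakALowerBound_holds`, to convert `o(𝔓)` into `o(𝔞𝔓)`.)
[cite: Zhang2022LandauSiegel, §7 Prop 7.1 (7.2); §8 Lemma 8.1, (8.3); §2 Lemma 2.3, Prop. 2.2 (i)] -/
theorem pairDictionary_of_meanValue {a b : (D : ℕ) → DirichletCharacter ℂ D → (ℕ → ℂ)} {B : ℝ} {g : ℂ}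
    (h71 : Prop71 c') (h81 : Lemma81 c') (h22 : Prop22i) (h23 : Lemma23 c')
    (hadm : ∀ (D : ℕ) (χ : DirichletCharacter ℂ D), Adm72 D B (a D χ) ∧ Adm72 D B (b D χ))
    (hmain : ∀ ε : ℝ, 0 < ε → ForAllLarge fun D _ χ => AssumptionA D χ →
      ‖(mainMV c' D (a D χ) (fun n => conj (b D χ n)) + conj (mainMV c' D (b D χ) (fun n => conj (a D χ n))))
          - g * ((frakA χ * frakP D : ℝ) : ℂ)‖ ≤ ε * (frakA χ * frakP D))
    (herr : ∀ ε : ℝ, 0 < ε → ForAllLarge fun D _ χ => AssumptionA D χ →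
      Ecal c' D (a D χ) (fun n => conj (b D χ n)) ≤ ε * (frakA χ * frakP D) ∧
        Ecal c' D (b D χ) (fun n => conj (a D χ n)) ≤ ε * (frakA χ * frakP D)) :
    PairDictionary c' (fun D χ x s => Apoly x (a D χ) s) (fun D χ x s => Apoly x (b D χ) s) g := by
  intro ε hε
  obtain ⟨a₀, ha₀, hAlow⟩ := frakALowerBound_holds
  set ε₁ : ℝ := ε * a₀ / 8 with hε₁
  have hε₁pos : 0 < ε₁ := by positivity
  obtain ⟨C, hC⟩ := h71 B ε₁ hε₁pos
  have h81' := h81 B ε₁ hε₁pos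
  set ε₂ : ℝ := ε / (8 * (|C| + 1)) with hε₂
  have hε₂pos : 0 < ε₂ := by positivity
  have hmain' := hmain (ε / 8) (by positivity)
  have herr' := herr ε₂ hε₂pos
  have h3 : ForAllLarge fun D _ _ => 3 ≤ D := ForAllLarge.of_le 3 fun D _ _ hD _ _ => hD
  refine ((((((hC.and h81').and hmain').and herr').and hAlow).and (h22.and h23)).and h3).mono ?_
  intro D _ χ _ _ hall hA
  obtain ⟨⟨⟨⟨⟨⟨h71D, h81D⟩, hmD⟩, heD⟩, hAD⟩, ⟨h22D, h23D⟩⟩, hD3⟩ := hall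
  have hadmA : Adm72 D B (a D χ) := (hadm D χ).1
  have hadmB : Adm72 D B (b D χ) := (hadm D χ).2
  have e71a : ‖Theta1 c' χ (a D χ) (fun n => conj (b D χ n)) - mainMV c' D (a D χ) (fun n => conj (b D χ n))‖ ≤
      C * Ecal c' D (a D χ) (fun n => conj (b D χ n)) + ε₁ * frakP D := h71D hA _ _ hadmA (Section8aStatements.adm72_conj hadmB)
  have e71b : ‖Theta1 c' χ (b D χ) (fun n => conj (a D χ n)) - mainMV c' D (b D χ) (fun n => conj (a D χ n))‖ ≤
      C * Ecal c' D (b D χ) (fun n => conj (a D χ n)) + ε₁ * frakP D := h71D hA _ _ hadmB (Section8aStatements.adm72_conj hadmA)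
  have e81 : ‖lhs81 c' χ (a D χ) (fun n => conj (b D χ n)) -
      (Theta1 c' χ (a D χ) (fun n => conj (b D χ n)) + conj (Theta1 c' χ (b D χ) (fun n => conj (a D χ n))))‖ ≤
      ε₁ * frakP D := by
    simpa only [Complex.conj_conj] using h81D hA _ _ hadmA (Section8aStatements.adm72_conj hadmB)
  have hmD' := hmD hA
  obtain ⟨hea, heb⟩ := heD hA
  have ha0 : a₀ ≤ frakA χ := hAD hA
  have hP : 0 ≤ frakP D := frakP_nonneg D
  have hAP : 0 ≤ frakA χ * frakP D := mul_nonneg (ha₀.le.trans ha0) hP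
  rw [discPolar_apoly_eq_lhs81 hD3 h23D h22D]
  set L := lhs81 c' χ (a D χ) (fun n => conj (b D χ n)) with hL
  set Θa := Theta1 c' χ (a D χ) (fun n => conj (b D χ n)) with hΘa
  set Θb := Theta1 c' χ (b D χ) (fun n => conj (a D χ n)) with hΘb
  set Ma := mainMV c' D (a D χ) (fun n => conj (b D χ n)) with hMa
  set Mb := mainMV c' D (b D χ) (fun n => conj (a D χ n)) with hMb
  set Ea := Ecal c' D (a D χ) (fun n => conj (b D χ n)) with hEa
  set Eb := Ecal c' D (b D χ) (fun n => conj (a D χ n)) with hEb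
  set R : ℂ := g * ((frakA χ * frakP D : ℝ) : ℂ) with hR
  have key : L - R = (L - (Θa + conj Θb)) + ((Θa - Ma) + conj (Θb - Mb)) + ((Ma + conj Mb) - R) := by
    simp only [map_sub]; ring
  have hEa0 : 0 ≤ Ea := Ecal_nonneg _ _ _ _
  have hEb0 : 0 ≤ Eb := Ecal_nonneg _ _ _ _
  have hCε : |C| * ε₂ ≤ ε / 8 := by
    rw [hε₂, ← mul_div_assoc, div_le_div_iff₀ (by positivity) (by norm_num)]
    nlinarith [abs_nonneg C, hε.le]
  have hCEa : C * Ea ≤ ε / 8 * (frakA χ * frakP D) :=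
    calc C * Ea ≤ |C| * Ea := mul_le_mul_of_nonneg_right (le_abs_self C) hEa0
      _ ≤ |C| * (ε₂ * (frakA χ * frakP D)) := mul_le_mul_of_nonneg_left hea (abs_nonneg C)
      _ = (|C| * ε₂) * (frakA χ * frakP D) := by ring
      _ ≤ ε / 8 * (frakA χ * frakP D) := mul_le_mul_of_nonneg_right hCε hAP
  have hCEb : C * Eb ≤ ε / 8 * (frakA χ * frakP D) :=
    calc C * Eb ≤ |C| * Eb := mul_le_mul_of_nonneg_right (le_abs_self C) hEb0
      _ ≤ |C| * (ε₂ * (frakA χ * frakP D)) := mul_le_mul_of_nonneg_left heb (abs_nonneg C)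
      _ = (|C| * ε₂) * (frakA χ * frakP D) := by ring
      _ ≤ ε / 8 * (frakA χ * frakP D) := mul_le_mul_of_nonneg_right hCε hAP
  have hε₁le : ε₁ * frakP D ≤ ε / 8 * (frakA χ * frakP D) := by
    rw [hε₁]
    have h := mul_le_mul_of_nonneg_right ha0 hP
    have : ε * a₀ / 8 * frakP D = ε / 8 * (a₀ * frakP D) := by ring
    rw [this]
    exact mul_le_mul_of_nonneg_left h (by positivity)
  calc ‖L - R‖ = ‖(L - (Θa + conj Θb)) + ((Θa - Ma) + conj (Θb - Mb)) + ((Ma + conj Mb) - R)‖ := by rw [key]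
    _ ≤ ‖L - (Θa + conj Θb)‖ + ‖(Θa - Ma) + conj (Θb - Mb)‖ + ‖(Ma + conj Mb) - R‖ := norm_add₃_le
    _ ≤ ‖L - (Θa + conj Θb)‖ + (‖Θa - Ma‖ + ‖conj (Θb - Mb)‖) + ‖(Ma + conj Mb) - R‖ := by
        gcongr; exact norm_add_le _ _
    _ = ‖L - (Θa + conj Θb)‖ + (‖Θa - Ma‖ + ‖Θb - Mb‖) + ‖(Ma + conj Mb) - R‖ := by rw [Complex.norm_conj]
    _ ≤ ε₁ * frakP D + ((C * Ea + ε₁ * frakP D) + (C * Eb + ε₁ * frakP D)) + ε / 8 * (frakA χ * frakP D) := by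
        gcongr
    _ ≤ ε / 8 * (frakA χ * frakP D) + ((ε / 8 * (frakA χ * frakP D) + ε / 8 * (frakA χ * frakP D)) +
          (ε / 8 * (frakA χ * frakP D) + ε / 8 * (frakA χ * frakP D))) + ε / 8 * (frakA χ * frakP D) := by
        gcongr
    _ ≤ ε * (frakA χ * frakP D) := by nlinarith [hAP, hε.le]

/-- **The same entry with Lemma 8.1 / Prop. 2.2 (i) / Lemma 2.3 DISCHARGED:** for every sufficiently large `c′`,
Prop. 7.1 at `c′` (displayed here; DISCHARGED in Part 8, `pairDictionary_of_meanValue_closed'`) and the two evaluation rows (M), (E) give the entry — the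
residual «dictionary step» for (7.2)-admissible tables is EXACTLY Prop. 7.1 ∧ (M) ∧ (E).
[cite: Zhang2022LandauSiegel, §7 Prop 7.1 (7.2); §8 Lemma 8.1; §2 Lemma 2.3, Prop. 2.2 (i)] -/
theorem pairDictionary_of_meanValue_closed :
    ∃ c₀ : ℝ, 0 ≤ c₀ ∧ ∀ c' : ℝ, c₀ ≤ c' → Prop71 c' →
      ∀ {a b : (D : ℕ) → DirichletCharacter ℂ D → (ℕ → ℂ)} {B : ℝ} {g : ℂ},
      (∀ (D : ℕ) (χ : DirichletCharacter ℂ D), Adm72 D B (a D χ) ∧ Adm72 D B (b D χ)) →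
      (∀ ε : ℝ, 0 < ε → ForAllLarge fun D _ χ => AssumptionA D χ →
        ‖(mainMV c' D (a D χ) (fun n => conj (b D χ n)) + conj (mainMV c' D (b D χ) (fun n => conj (a D χ n))))
            - g * ((frakA χ * frakP D : ℝ) : ℂ)‖ ≤ ε * (frakA χ * frakP D)) →
      (∀ ε : ℝ, 0 < ε → ForAllLarge fun D _ χ => AssumptionA D χ →
        Ecal c' D (a D χ) (fun n => conj (b D χ n)) ≤ ε * (frakA χ * frakP D) ∧
          Ecal c' D (b D χ) (fun n => conj (a D χ n)) ≤ ε * (frakA χ * frakP D)) →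
      PairDictionary c' (fun D χ x s => Apoly x (a D χ) s) (fun D χ x s => Apoly x (b D χ) s) g := by
  obtain ⟨c₀, h0, h⟩ := partOne_eventually
  exact ⟨c₀, h0, fun c' hc' h71 _ _ _ _ hadm hmain herr =>
    pairDictionary_of_meanValue h71 (h c' hc').2.2.1 prop22i_holds (h c' hc').2.1 hadm hmain herr⟩

/-- **The `k = 1` reading (one (7.2)-admissible table, the bulk entry):** Prop. 7.1 at `c′ ≥ c₀` and the two rows
(M) «`2Re mainMV(𝐚,𝐚̄) = m·𝔞𝔓 + o(𝔞𝔓)`» (stated as the symmetrised complex form with a real constant `m`) and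
(E) «`E(𝐚,𝐚̄) = o(𝔞𝔓)`» give the member's `EStarLen`-shape asymptotic `Ξ(T_𝐚) = m·𝔞𝔓 + o(𝔞𝔓)` under (A) — the
input shape of the closed endgame `eventually_not_assumptionA_of_negative_mainTerm_family_closed` (Part 2).
[cite: Zhang2022LandauSiegel, §7 Prop 7.1 (7.2); §8 (8.3), Lemma 8.1; §2 (2.16)] -/
theorem discMean_apoly_of_meanValue_closed :
    ∃ c₀ : ℝ, 0 ≤ c₀ ∧ ∀ c' : ℝ, c₀ ≤ c' → Prop71 c' →
      ∀ {a : (D : ℕ) → DirichletCharacter ℂ D → (ℕ → ℂ)} {B m : ℝ},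
      (∀ (D : ℕ) (χ : DirichletCharacter ℂ D), Adm72 D B (a D χ)) →
      (∀ ε : ℝ, 0 < ε → ForAllLarge fun D _ χ => AssumptionA D χ →
        ‖(mainMV c' D (a D χ) (fun n => conj (a D χ n)) + conj (mainMV c' D (a D χ) (fun n => conj (a D χ n))))
            - (m : ℂ) * ((frakA χ * frakP D : ℝ) : ℂ)‖ ≤ ε * (frakA χ * frakP D)) →
      (∀ ε : ℝ, 0 < ε → ForAllLarge fun D _ χ => AssumptionA D χ →
        Ecal c' D (a D χ) (fun n => conj (a D χ n)) ≤ ε * (frakA χ * frakP D)) →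
      ∀ ε : ℝ, 0 < ε → ForAllLarge fun D _ χ => AssumptionA D χ →
        |discMean c' χ (fun x s => Apoly x (a D χ) s) - m * frakA χ * frakP D| ≤ ε * frakA χ * frakP D := by
  obtain ⟨c₀, h0, h⟩ := pairDictionary_of_meanValue_closed
  refine ⟨c₀, h0, fun c' hc' h71 a B m hadm hmain herr => ?_⟩
  have hP : PairDictionary c' (fun D χ x s => Apoly x (a D χ) s) (fun D χ x s => Apoly x (a D χ) s) (m : ℂ) :=
    h c' hc' h71 (fun D χ => ⟨hadm D χ, hadm D χ⟩) hmain
      (fun ε hε => (herr ε hε).mono fun _ _ _ _ _ hD hA => ⟨hD hA, hD hA⟩)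
  simpa only [Complex.ofReal_re] using pairDictionary_self_discMean hP

end MeanValueEntry

/-! ### Part 7 — completion of the N12 list for the remaining rows of the class of record whose authors' seats are
closed: E-035 discrete (`KnifeEdgeWallCross`, p459102 — this seat's file) and the E-004 band-scale rows 31–33 / 35–38
(`RepairBandEdge` p469716, `RepairBandMeanValue` p470415/p471890 — ls-barrier-p2 g2, generation closed 22:36Z).
(The B-len rows E-002 / E-070 / E-071 / E-17 are closed in the sibling leaf `KnifeEdgeEndgameClosedBlen`, p477630;
E-20 `RepairBlenNuLipschitz` / E-074′ `KnifeEdgeNuInvisiblePsiOne` and the §D len files `KnifeEdgeLenSiegel*` are left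
to their live authors.) -/

section Completion

/-- **E-035 at the discrete level (p459102), closed:** for every sufficiently large `c′`, a wall design whose discrete
cross pairing sits at `≤ −κ·Ξ(bulk)` with `κ > 2` at saturation refutes (A) eventually and gives Theorems 1 and 2 —
only `ECrossNegDiscrete` displayed. [cite: Zhang2022LandauSiegel, §1 Theorems 1–2; §2 Lemma 2.3, Prop. 2.2 (i), (2.15)–(2.17)] -/
theorem theorem1_of_crossNegDiscrete_closed :
    ∃ c₀ : ℝ, 0 ≤ c₀ ∧ ∀ c' : ℝ, c₀ ≤ c' → ∀ {κ : ℝ} {Λ : BandScale}, 2 < κ → ECrossNegDiscrete c' κ Λ →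
      (∃ D₀ : ℕ, ∀ (D : ℕ) [NeZero D] (χ : DirichletCharacter ℂ D),
          D₀ ≤ D → χ.IsQuadratic → χ.IsPrimitive → ¬ AssumptionA D χ) ∧ Theorem1 ∧ Theorem2 := by
  obtain ⟨c₀, h0, h⟩ := lemma23_eventually
  refine ⟨c₀, h0, fun c' hc' _ _ hκ hE => ?_⟩
  have h1 : Theorem1 := theorem1_of_crossNegDiscrete hκ hE prop22i_holds (h c' hc')
  exact ⟨eventually_not_assumptionA_of_crossNegDiscrete hκ hE prop22i_holds (h c' hc'), h1,
    Skeleton.theorem2_of_theorem1 h1⟩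

/-- **Band-edge flatness at the MAIN scale (row 31 engine `Repair.discMeanFlat_bandEdge_mainScale`, p469716), with only
Prop. 7.1 displayed:** for every sufficiently large `c′`, `Prop71 c′` gives, for all large `D` under (A) and the displayed
`Re ρ = ½`, `|discMean(N₂) − discMean(N₁)| ≤ 𝓛^{−A}·discMeanAbs(N₁) + 3·𝓛⁹·𝓛^{−A}·𝔓` on the band-scale window.
[cite: Zhang2022LandauSiegel, §2 (2.16), (2.30); §7 Prop 7.1; §8 Lemma 8.1] -/
theorem discMeanFlat_bandEdge_mainScale_closed :
    ∃ c₀ : ℝ, 0 ≤ c₀ ∧ ∀ c' : ℝ, c₀ ≤ c' → Prop71 c' → ∀ {δ : ℝ}, 0 < δ → ∀ A : ℕ,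
      ForAllLarge fun D _ χ => AssumptionA D χ →
        (∀ i ∈ Skeleton.idx χ, (i.2).re = 1 / 2) →
          ∀ g : ℝ → ℂ, LipschitzWith 1 g → (∀ z, ‖g z‖ ≤ 1) →
            ∀ N₁ N₂ : ℕ, ⌈(D : ℝ) * bigP D * ell D ^ (1058 + 2 * A)⌉₊ + 1 ≤ N₁ → N₁ ≤ N₂ →
              N₂ ≤ ⌈bigP D ^ (1 + δ)⌉₊ →
              |Repair.discMean c' χ g N₂ - Repair.discMean c' χ g N₁| ≤
                (ell D ^ A)⁻¹ * Repair.discMeanAbs c' χ g N₁ + 3 * ell D ^ 9 * (ell D ^ A)⁻¹ * frakP D := by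
  obtain ⟨c₀, h0, h⟩ := partOne_eventually
  exact ⟨c₀, h0, fun c' hc' h71 _ hδ A =>
    Repair.discMeanFlat_bandEdge_mainScale c' hδ A h71 (h c' hc').2.2.1 prop22i_holds (h c' hc').2.1⟩

/-- **E-004 FINAL FORM (rows 35–38: `DiscMeanTrueBandAOn (WallZeroLip K)`, p470415/p471890), with only Prop. 7.1 and
the band mean value E-004′(κ) displayed:** for every sufficiently large `c′`, `κ < 6`, `BandMeanValue c′ m κ` and
`Prop71 c′` give the true-band slot on the Lipschitz wall-zero class for every `η > 0`.
[cite: Zhang2022LandauSiegel, §2 (2.16)–(2.20), (2.30)–(2.31); §7 Prop 7.1; §8 Lemma 8.1] -/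
theorem discMeanTrueBandAOn_wallZeroLip_of_bandMeanValue_closed :
    ∃ c₀ : ℝ, 0 ≤ c₀ ∧ ∀ c' : ℝ, c₀ ≤ c' → Prop71 c' → ∀ (m : ℕ) (K : NNReal) {κ η : ℝ}, κ < 6 → 0 < η →
      Repair.BandMeanValue c' m κ → Repair.DiscMeanTrueBandAOn (Repair.WallZeroLip K) c' m η := by
  obtain ⟨c₀, h0, h⟩ := partOne_eventually
  exact ⟨c₀, h0, fun c' hc' h71 m K _ _ hκ hη hB =>
    Repair.discMeanTrueBandAOn_wallZeroLip_of_bandMeanValue c' m K hκ hη hB h71 (h c' hc').2.2.1 prop22i_holds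
      (h c' hc').2.1⟩

/-- **… the wall-zero slot `DiscMeanTrueBandA` (rows 35–36) and the glued slot `DiscMeanTrueBandAKM` (rows 37–38),
closed.** [cite: Zhang2022LandauSiegel, §2 (2.16)–(2.20), (2.30)–(2.31); §7 Prop 7.1; §8 Lemma 8.1] -/
theorem discMeanTrueBandA_of_bandMeanValue_closed :
    ∃ c₀ : ℝ, 0 ≤ c₀ ∧ ∀ c' : ℝ, c₀ ≤ c' → Prop71 c' → ∀ (m : ℕ) (K : NNReal) (M : ℝ) {κ η : ℝ}, κ < 6 → 0 < η →
      Repair.BandMeanValue c' m κ →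
      Repair.DiscMeanTrueBandA c' m η ∧ Repair.DiscMeanTrueBandAKM c' K M m η := by
  obtain ⟨c₀, h0, h⟩ := partOne_eventually
  exact ⟨c₀, h0, fun c' hc' h71 m K M _ _ hκ hη hB =>
    ⟨Repair.discMeanTrueBandA_of_bandMeanValue c' m hκ hη hB h71 (h c' hc').2.2.1 prop22i_holds (h c' hc').2.1,
      Repair.discMeanTrueBandAKM_of_bandMeanValue c' K M m hκ hη hB h71 (h c' hc').2.2.1 prop22i_holds
        (h c' hc').2.1⟩⟩

end Completion

/-! ### Part 8 — Proposition 7.1 DISCHARGED: the twins of Parts 5–7 with `Prop71 c′` fed by the tree theorem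
`Section7cStatements.prop71X_holds : ∀ c′, Skeleton.Prop71 c′` (module `Section7Prop71Holds`; finding of
ls-Blen-typer-1 g4, INBOX 2026-08-27T00:27:55Z, hand-over snippet `UnitsLemmaFullyClosed.snippet.lean`
c987bcce47a3ede3). After this Part, NO manuscript node of Part I (§§2–4, §7, §8: Prop. 2.2 (i), Lemma 2.3, Lemma 8.1,
Prop. 7.1) is displayed in any row of this leaf; what remains displayed is exactly the analytic SLOTS and the
IDENTIFICATION rows ((7.2)-admissibility, (M), (E), E-004′ `BandMeanValue`, the dictionaries) and (A). In the row-31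
twin the world binder «`Re ρ = ½` on `idx χ`» is discharged as well (it is `Prop22i` read pointwise:
`Section11Deductions.mem_idx` + `mem_prodZeroSetOmega_of_mem_zeroSet`). No class, row or verdict of
`Repair.Rplusplus<k>` changes. -/

section Prop71Discharged

/-- **`discWeight = (8/π)·𝓛⁹·𝔓·(1 + o(1))`, FULLY CLOSED** — Prop. 7.1 (`Section7cStatements.prop71X_holds`),
Lemma 8.1, Prop. 2.2 (i) and Lemma 2.3 all discharged by tree theorems: for every sufficiently large `c′` and every
`ε > 0` there is `C` with `|discWeight c′ χ − (8/π)·𝓛⁹·𝔓| ≤ (C·𝓛² + ε)·𝔓` for all large `D` under (A) — the units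
lemma of the class of record with NOTHING displayed. [cite: Zhang2022LandauSiegel, §7 Prop 7.1, §8 Lemma 8.1, §2 Lemma 2.3] -/
theorem discWeight_trivialScale_closed' :
    ∃ c₀ : ℝ, 0 ≤ c₀ ∧ ∀ c' : ℝ, c₀ ≤ c' →
      ∀ ε : ℝ, 0 < ε → ∃ C : ℝ, ForAllLarge fun D _ χ => AssumptionA D χ →
        |Repair.discWeight c' χ - 8 / π * ell D ^ 9 * frakP D| ≤ (C * ell D ^ 2 + ε) * frakP D := by
  obtain ⟨c₀, h0, h⟩ := discWeight_trivialScale_closed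
  exact ⟨c₀, h0, fun c' hc' => h c' hc' (Section7cStatements.prop71X_holds c')⟩

/-- **The Prop. 7.1 / Lemma 8.1 ENTRY of the Gram dictionary with every manuscript node discharged:** for every
sufficiently large `c′`, (7.2)-admissibility of the two coefficient tables and the two evaluation rows (M) «symmetrised
main term `= g·𝔞𝔓 + o(𝔞𝔓)` under (A)» and (E) «`E(𝐚,𝐛̄), E(𝐛,𝐚̄) = o(𝔞𝔓)` under (A)» give `PairDictionary c′ T_𝐚 T_𝐛 g` —
the residual «dictionary step» for (7.2)-admissible tables is EXACTLY (M) ∧ (E).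
[cite: Zhang2022LandauSiegel, §7 Prop 7.1 (7.2); §8 Lemma 8.1, (8.3); §2 Lemma 2.3, Prop. 2.2 (i)] -/
theorem pairDictionary_of_meanValue_closed' :
    ∃ c₀ : ℝ, 0 ≤ c₀ ∧ ∀ c' : ℝ, c₀ ≤ c' →
      ∀ {a b : (D : ℕ) → DirichletCharacter ℂ D → (ℕ → ℂ)} {B : ℝ} {g : ℂ},
      (∀ (D : ℕ) (χ : DirichletCharacter ℂ D), Adm72 D B (a D χ) ∧ Adm72 D B (b D χ)) →
      (∀ ε : ℝ, 0 < ε → ForAllLarge fun D _ χ => AssumptionA D χ →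
        ‖(mainMV c' D (a D χ) (fun n => conj (b D χ n)) + conj (mainMV c' D (b D χ) (fun n => conj (a D χ n))))
            - g * ((frakA χ * frakP D : ℝ) : ℂ)‖ ≤ ε * (frakA χ * frakP D)) →
      (∀ ε : ℝ, 0 < ε → ForAllLarge fun D _ χ => AssumptionA D χ →
        Ecal c' D (a D χ) (fun n => conj (b D χ n)) ≤ ε * (frakA χ * frakP D) ∧
          Ecal c' D (b D χ) (fun n => conj (a D χ n)) ≤ ε * (frakA χ * frakP D)) →
      PairDictionary c' (fun D χ x s => Apoly x (a D χ) s) (fun D χ x s => Apoly x (b D χ) s) g := by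
  obtain ⟨c₀, h0, h⟩ := pairDictionary_of_meanValue_closed
  exact ⟨c₀, h0, fun c' hc' _ _ _ _ hadm hmain herr =>
    h c' hc' (Section7cStatements.prop71X_holds c') hadm hmain herr⟩

/-- **The `k = 1` reading with every manuscript node discharged:** for every sufficiently large `c′`, one
(7.2)-admissible table with the rows (M) «`2Re mainMV(𝐚,𝐚̄) = m·𝔞𝔓 + o(𝔞𝔓)`» and (E) «`E(𝐚,𝐚̄) = o(𝔞𝔓)`» has the
`EStarLen`-shape asymptotic `Ξ(T_𝐚) = m·𝔞𝔓 + o(𝔞𝔓)` under (A) — the input of the closed family endgame of Part 2.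
[cite: Zhang2022LandauSiegel, §7 Prop 7.1 (7.2); §8 (8.3), Lemma 8.1; §2 (2.16)] -/
theorem discMean_apoly_of_meanValue_closed' :
    ∃ c₀ : ℝ, 0 ≤ c₀ ∧ ∀ c' : ℝ, c₀ ≤ c' →
      ∀ {a : (D : ℕ) → DirichletCharacter ℂ D → (ℕ → ℂ)} {B m : ℝ},
      (∀ (D : ℕ) (χ : DirichletCharacter ℂ D), Adm72 D B (a D χ)) →
      (∀ ε : ℝ, 0 < ε → ForAllLarge fun D _ χ => AssumptionA D χ →
        ‖(mainMV c' D (a D χ) (fun n => conj (a D χ n)) + conj (mainMV c' D (a D χ) (fun n => conj (a D χ n))))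
            - (m : ℂ) * ((frakA χ * frakP D : ℝ) : ℂ)‖ ≤ ε * (frakA χ * frakP D)) →
      (∀ ε : ℝ, 0 < ε → ForAllLarge fun D _ χ => AssumptionA D χ →
        Ecal c' D (a D χ) (fun n => conj (a D χ n)) ≤ ε * (frakA χ * frakP D)) →
      ∀ ε : ℝ, 0 < ε → ForAllLarge fun D _ χ => AssumptionA D χ →
        |discMean c' χ (fun x s => Apoly x (a D χ) s) - m * frakA χ * frakP D| ≤ ε * frakA χ * frakP D := by
  obtain ⟨c₀, h0, h⟩ := discMean_apoly_of_meanValue_closed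
  exact ⟨c₀, h0, fun c' hc' _ _ _ hadm hmain herr =>
    h c' hc' (Section7cStatements.prop71X_holds c') hadm hmain herr⟩

/-- **Band-edge flatness at the MAIN scale (row-31 engine, p469716) with ONLY (A) displayed:** for every sufficiently
large `c′`, every `δ > 0` and `A`, for all large `D` under (A): for every `1`-Lipschitz profile bounded by `1`,
`|discMean(N₂) − discMean(N₁)| ≤ 𝓛^{−A}·discMeanAbs(N₁) + 3·𝓛⁹·𝓛^{−A}·𝔓` on the band-scale window
`⌈D·P·𝓛^{1058+2A}⌉ + 1 ≤ N₁ ≤ N₂ ≤ ⌈P^{1+δ}⌉`. Prop. 7.1 is fed by `prop71X_holds`; the world binder «`Re ρ = ½` on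
`idx χ`» of the landed form is Prop. 2.2 (i) read pointwise and is fed by `prop22i_holds`.
[cite: Zhang2022LandauSiegel, §2 (2.16), (2.30), Prop. 2.2 (i); §7 Prop 7.1; §8 Lemma 8.1] -/
theorem discMeanFlat_bandEdge_mainScale_closed' :
    ∃ c₀ : ℝ, 0 ≤ c₀ ∧ ∀ c' : ℝ, c₀ ≤ c' → ∀ {δ : ℝ}, 0 < δ → ∀ A : ℕ,
      ForAllLarge fun D _ χ => AssumptionA D χ →
        ∀ g : ℝ → ℂ, LipschitzWith 1 g → (∀ z, ‖g z‖ ≤ 1) →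
          ∀ N₁ N₂ : ℕ, ⌈(D : ℝ) * bigP D * ell D ^ (1058 + 2 * A)⌉₊ + 1 ≤ N₁ → N₁ ≤ N₂ →
            N₂ ≤ ⌈bigP D ^ (1 + δ)⌉₊ →
            |Repair.discMean c' χ g N₂ - Repair.discMean c' χ g N₁| ≤
              (ell D ^ A)⁻¹ * Repair.discMeanAbs c' χ g N₁ + 3 * ell D ^ 9 * (ell D ^ A)⁻¹ * frakP D := by
  obtain ⟨c₀, h0, h⟩ := discMeanFlat_bandEdge_mainScale_closed
  refine ⟨c₀, h0, fun c' hc' _ hδ A => ?_⟩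
  refine ((h c' hc' (Section7cStatements.prop71X_holds c') hδ A).and prop22i_holds).mono ?_
  intro D _ χ _ _ hh hA g hg hg1 N₁ N₂ h₁ h₂ h₃
  obtain ⟨h31, h22⟩ := hh
  have hline : ∀ i ∈ Skeleton.idx χ, (i.2).re = 1 / 2 := fun i hi => by
    obtain ⟨hi1, hi2⟩ := Section11Deductions.mem_idx χ hi
    exact h22 i.1 hi1 i.2 (mem_prodZeroSetOmega_of_mem_zeroSet χ hi2)
  exact h31 hA hline g hg hg1 N₁ N₂ h₁ h₂ h₃

/-- **E-004 FINAL FORM (rows 35–38) with ONLY the band mean value E-004′(κ) displayed:** for every sufficiently large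
`c′`, `κ < 6` and `BandMeanValue c′ m κ` give the true-band slot `DiscMeanTrueBandAOn (WallZeroLip K) c′ m η` for every
`η > 0` (Prop. 7.1 fed by `prop71X_holds`, Lemma 8.1 / Prop. 2.2 (i) / Lemma 2.3 by Part 1).
[cite: Zhang2022LandauSiegel, §2 (2.16)–(2.20), (2.30)–(2.31); §7 Prop 7.1; §8 Lemma 8.1] -/
theorem discMeanTrueBandAOn_wallZeroLip_of_bandMeanValue_closed' :
    ∃ c₀ : ℝ, 0 ≤ c₀ ∧ ∀ c' : ℝ, c₀ ≤ c' → ∀ (m : ℕ) (K : NNReal) {κ η : ℝ}, κ < 6 → 0 < η →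
      Repair.BandMeanValue c' m κ → Repair.DiscMeanTrueBandAOn (Repair.WallZeroLip K) c' m η := by
  obtain ⟨c₀, h0, h⟩ := discMeanTrueBandAOn_wallZeroLip_of_bandMeanValue_closed
  exact ⟨c₀, h0, fun c' hc' m K _ _ hκ hη hB =>
    h c' hc' (Section7cStatements.prop71X_holds c') m K hκ hη hB⟩

/-- **… and the wall-zero slot `DiscMeanTrueBandA` (rows 35–36) and the glued slot `DiscMeanTrueBandAKM` (rows 37–38)
with ONLY E-004′ displayed.** [cite: Zhang2022LandauSiegel, §2 (2.16)–(2.20), (2.30)–(2.31); §7 Prop 7.1; §8 Lemma 8.1] -/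
theorem discMeanTrueBandA_of_bandMeanValue_closed' :
    ∃ c₀ : ℝ, 0 ≤ c₀ ∧ ∀ c' : ℝ, c₀ ≤ c' → ∀ (m : ℕ) (K : NNReal) (M : ℝ) {κ η : ℝ}, κ < 6 → 0 < η →
      Repair.BandMeanValue c' m κ →
      Repair.DiscMeanTrueBandA c' m η ∧ Repair.DiscMeanTrueBandAKM c' K M m η := by
  obtain ⟨c₀, h0, h⟩ := discMeanTrueBandA_of_bandMeanValue_closed
  exact ⟨c₀, h0, fun c' hc' m K M _ _ hκ hη hB =>
    h c' hc' (Section7cStatements.prop71X_holds c') m K M hκ hη hB⟩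

end Prop71Discharged

/-! ### Part 9 — the structural world binders (b), (w) ELIMINATED, and the band rows of `RepairRplusBandMV` (p477819;
v2 p480299 = ROWS OF RECORD 41′–44′, ls-barrier-p2 g3) read CLOSED: the CLEAN FROM-THE-WALL theorems (for any
coefficient-class slot `BandMeanValueOn 𝒞`, and for the slot of record E-004″ `BandMeanValueLip` = the class's OWN
coefficient sequences) and the four BandMVLip row verdicts with EVERY manuscript node (Prop. 7.1, Lemma 8.1,
Prop. 2.2 (i), Lemma 2.3) AND the world binder (b) «`Re ρ = ½` on `idx χ`» discharged — ONLY the band mean-square slot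
E-004″ `Repair.BandMeanValueLip c′ K 1078 κ` (`κ < 6`) and (A) displayed. The (b) binder is Prop. 2.2 (i) read pointwise on the
index set (`idx_re_half_of`, `idx_re_half_eventually`); since `prop22i_holds` is a tree theorem it holds for all large
`D` with NO hypothesis, so every row of the class of record that displays (b) inside its `ForAllLarge` drops it by the
generic eliminators `forAllLarge_of_idx_re_half` / `forAllLarge_of_assumptionA_idx_re_half` (one term each). The other
structural reading, (w) «weights `Re 𝔠*·Re ω ≥ 0` on `idx χ`» (= (B1) pointwise, Lemma 2.3 + Prop. 2.2 (i),
`weights_nonneg_of`), holds for all large `D` for every `c′ ≥ c₀` (`weights_nonneg_eventually`) and is eliminated the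
same way (`forAllLarge_of_weights_nonneg`, `forAllLarge_of_world_binders`). No class, row or verdict of
`Repair.Rplusplus<k>` changes (the rows keep their landed displayed form; these are companion readings). -/

section FromTheWallClosed

/-- **The world binder (b) is Prop. 2.2 (i) read pointwise:** at a modulus where Prop. 2.2 (i) holds pointwise, every
index `(ψ, ρ) ∈ idx χ` has `Re ρ = ½`. [cite: Zhang2022LandauSiegel, §2 Prop. 2.2 (i), (2.15)–(2.17)] -/
theorem idx_re_half_of {D : ℕ} [NeZero D] (χ : DirichletCharacter ℂ D)
    (h22 : ∀ x ∈ PsiOne χ, ∀ s ∈ prodZeroSetOmega χ x, s.re = 1 / 2) :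
    ∀ i ∈ Skeleton.idx χ, (i.2).re = 1 / 2 := fun i hi => by
  obtain ⟨hi1, hi2⟩ := Section11Deductions.mem_idx χ hi
  exact h22 i.1 hi1 i.2 (mem_prodZeroSetOmega_of_mem_zeroSet χ hi2)

/-- **The world binder (b) holds for all large `D`, unconditionally** (`Skeleton.prop22i_holds` pointwise): the
hypothesis «`∀ i ∈ idx χ, Re ρ = ½`» displayed in the rows of the class of record is a tree theorem in the `ForAllLarge`
reading. [cite: Zhang2022LandauSiegel, §2 Prop. 2.2 (i), (2.15)–(2.17)] -/
theorem idx_re_half_eventually : ForAllLarge fun _ _ χ => ∀ i ∈ Skeleton.idx χ, (i.2).re = 1 / 2 :=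
  prop22i_holds.mono fun _ _ χ _ _ h22 => idx_re_half_of χ h22

/-- **Generic (b)-ELIMINATOR:** an eventual statement displayed «GIVEN (b)» holds eventually WITHOUT (b). Every row of
the class of record whose verdict reads `ForAllLarge (… (∀ i ∈ idx χ, Re ρ = ½) → T)` drops the binder by this lemma.
[cite: Zhang2022LandauSiegel, §2 Prop. 2.2 (i), p. 4 («for all large D»)] -/
theorem forAllLarge_of_idx_re_half {T : (D : ℕ) → [NeZero D] → DirichletCharacter ℂ D → Prop}
    (h : ForAllLarge fun D _ χ => (∀ i ∈ Skeleton.idx χ, (i.2).re = 1 / 2) → T D χ) : ForAllLarge T :=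
  (h.and idx_re_half_eventually).mono fun _ _ _ _ _ hh => hh.1 hh.2

/-- **Generic (b)-ELIMINATOR under (A):** `ForAllLarge ((A) → (b) → T)` gives `ForAllLarge ((A) → T)`.
[cite: Zhang2022LandauSiegel, §2 Prop. 2.2 (i), p. 4] -/
theorem forAllLarge_of_assumptionA_idx_re_half {T : (D : ℕ) → [NeZero D] → DirichletCharacter ℂ D → Prop}
    (h : ForAllLarge fun D _ χ => AssumptionA D χ → (∀ i ∈ Skeleton.idx χ, (i.2).re = 1 / 2) → T D χ) :
    ForAllLarge fun D _ χ => AssumptionA D χ → T D χ :=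
  (h.and idx_re_half_eventually).mono fun _ _ _ _ _ hh hA => hh.1 hA hh.2

/-- **The world binder (w) «weights `Re 𝔠*(ρ,ψ)·Re ω(ρ) ≥ 0` on `idx χ`» holds for all large `D`, for every
sufficiently large `c′`** — Lemma 2.3 (`lemma23_eventually`) and Prop. 2.2 (i) (`prop22i_holds`) read pointwise
(`weights_nonneg_of`, `D ≥ 3`): the structural positivity reading (B1) displayed in the rows of the class of record is a
tree theorem in the `c′`-eventual `ForAllLarge` reading. [cite: Zhang2022LandauSiegel, §2 Lemma 2.3, Prop. 2.2 (i), (2.15)] -/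
theorem weights_nonneg_eventually :
    ∃ c₀ : ℝ, 0 ≤ c₀ ∧ ∀ c' : ℝ, c₀ ≤ c' →
      ForAllLarge fun D _ χ => ∀ i ∈ Skeleton.idx χ, 0 ≤ (cstar c' D i.1 i.2).re * (omegaW D i.2).re := by
  obtain ⟨c₀, h0, h⟩ := lemma23_eventually
  refine ⟨c₀, h0, fun c' hc' => ?_⟩
  refine (((h c' hc').and prop22i_holds).and (ForAllLarge.of_le 3 fun D _ _ hD _ _ => hD)).mono ?_
  intro D _ χ _ _ hh
  exact weights_nonneg_of hh.2 hh.1.1 hh.1.2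

/-- **Generic (w)-ELIMINATOR:** for every sufficiently large `c′`, an eventual statement displayed «GIVEN the weights are
`≥ 0`» holds eventually WITHOUT that binder. [cite: Zhang2022LandauSiegel, §2 Lemma 2.3, Prop. 2.2 (i)] -/
theorem forAllLarge_of_weights_nonneg :
    ∃ c₀ : ℝ, 0 ≤ c₀ ∧ ∀ c' : ℝ, c₀ ≤ c' → ∀ {T : (D : ℕ) → [NeZero D] → DirichletCharacter ℂ D → Prop},
      (ForAllLarge fun D _ χ =>
        (∀ i ∈ Skeleton.idx χ, 0 ≤ (cstar c' D i.1 i.2).re * (omegaW D i.2).re) → T D χ) →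
      ForAllLarge T := by
  obtain ⟨c₀, h0, h⟩ := weights_nonneg_eventually
  exact ⟨c₀, h0, fun c' hc' _ hT => (hT.and (h c' hc')).mono fun _ _ _ _ _ hh => hh.1 hh.2⟩

/-- **Generic eliminator of BOTH structural world binders (b) `Re ρ = ½` and (w) `Re 𝔠*·Re ω ≥ 0`:** for every
sufficiently large `c′`, `ForAllLarge ((b) → (w) → T)` gives `ForAllLarge T` — after this, NO structural reading of
Prop. 2.2 (i) / Lemma 2.3 needs to stay displayed in any row of the class of record (N12, last clause).
[cite: Zhang2022LandauSiegel, §2 Lemma 2.3, Prop. 2.2 (i), (2.15)–(2.17)] -/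
theorem forAllLarge_of_world_binders :
    ∃ c₀ : ℝ, 0 ≤ c₀ ∧ ∀ c' : ℝ, c₀ ≤ c' → ∀ {T : (D : ℕ) → [NeZero D] → DirichletCharacter ℂ D → Prop},
      (ForAllLarge fun D _ χ => (∀ i ∈ Skeleton.idx χ, (i.2).re = 1 / 2) →
        (∀ i ∈ Skeleton.idx χ, 0 ≤ (cstar c' D i.1 i.2).re * (omegaW D i.2).re) → T D χ) →
      ForAllLarge T := by
  obtain ⟨c₀, h0, h⟩ := weights_nonneg_eventually
  exact ⟨c₀, h0, fun c' hc' _ hT => ((hT.and idx_re_half_eventually).and (h c' hc')).mono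
    fun _ _ _ _ _ hh => hh.1.1 hh.1.2 hh.2⟩

/-- **THE CLEAN FROM-THE-WALL THEOREM (bounded lengths), fully closed, for ANY coefficient-class slot**
(`Repair.discMean_fromWall_of_bandMeanValueOn`, p480299, with Prop. 7.1 / Lemma 8.1 / Prop. 2.2 (i) / Lemma 2.3 and
(b) discharged): for every sufficiently large `c′`, every `δ > 0`, `K`, `M`, `κ < 6`, `η > 0`, and every coefficient
class `𝒞` containing the coefficient sequences of `WallZeroLip K`, GIVEN ONLY the band mean-square slot
`BandMeanValueOn 𝒞 c′ 1078 κ`: for all large `D` under (A), for every profile `g` that is `K`-Lipschitz with `‖g‖ ≤ M`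
on `[1, ∞)` and `g(1) = 0`, and EVERY length `⌈P⌉ ≤ N ≤ ⌈P^{1+δ}⌉`:
`|discMean(N) − discMean(⌈P⌉)| ≤ η·(discMeanAbs(⌈P⌉) + 𝔞𝔓)`.
[cite: Zhang2022LandauSiegel, §2 (2.16)–(2.20), (2.30)–(2.31), Lemma 2.3, Prop. 2.2 (i); §5 Lemma 5.7; §7 Prop 7.1; §8 Lemma 8.1] -/
theorem discMean_fromWall_of_bandMeanValueOn_closed :
    ∃ c₀ : ℝ, 0 ≤ c₀ ∧ ∀ c' : ℝ, c₀ ≤ c' → ∀ {𝒞 : ℕ → (ℕ → ℂ) → Prop} {δ : ℝ}, 0 < δ →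
      ∀ (K : NNReal) (M : ℝ) {κ η : ℝ}, κ < 6 → 0 < η →
      (∀ (D : ℕ) (g : ℝ → ℂ), Repair.WallZeroLip K g → 𝒞 D (Repair.profCoef D g)) →
      Repair.BandMeanValueOn 𝒞 c' 1078 κ →
      ForAllLarge fun D _ χ => AssumptionA D χ →
        ∀ g : ℝ → ℂ, Repair.GluedWallZeroClass K M g → ∀ N : ℕ, ⌈bigP D⌉₊ ≤ N → N ≤ ⌈bigP D ^ (1 + δ)⌉₊ →
          |Repair.discMean c' χ g N - Repair.discMean c' χ g ⌈bigP D⌉₊| ≤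
            η * (Repair.discMeanAbs c' χ g ⌈bigP D⌉₊ + frakA χ * frakP D) := by
  obtain ⟨c₀, h0, h⟩ := partOne_eventually
  exact ⟨c₀, h0, fun c' hc' _ _ hδ K M _ _ hκ hη h𝒞 hB => forAllLarge_of_assumptionA_idx_re_half
    (Repair.discMean_fromWall_of_bandMeanValueOn c' hδ K M hκ hη h𝒞 hB (Section7cStatements.prop71X_holds c')
      (h c' hc').2.2.1 prop22i_holds (h c' hc').2.1)⟩

/-- **THE CLEAN FROM-THE-WALL THEOREM (top-vanishing profile, every length), fully closed, any coefficient-class slot**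
(`Repair.discMean_fromWall_topVanishing_of_bandMeanValueOn` with the four nodes and (b) discharged): as above, for a
profile of `GluedWallZeroClass K M` vanishing on `[θ, ∞)`, EVERY `N ≥ ⌈P⌉`.
[cite: Zhang2022LandauSiegel, §2 (2.16)–(2.20), (2.30)–(2.31), Prop. 2.2 (i); §7 Prop 7.1; §8 Lemma 8.1] -/
theorem discMean_fromWall_topVanishing_of_bandMeanValueOn_closed :
    ∃ c₀ : ℝ, 0 ≤ c₀ ∧ ∀ c' : ℝ, c₀ ≤ c' → ∀ {𝒞 : ℕ → (ℕ → ℂ) → Prop} (θ : ℝ) (K : NNReal) (M : ℝ) {κ η : ℝ},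
      κ < 6 → 0 < η →
      (∀ (D : ℕ) (g : ℝ → ℂ), Repair.WallZeroLip K g → 𝒞 D (Repair.profCoef D g)) →
      Repair.BandMeanValueOn 𝒞 c' 1078 κ →
      ForAllLarge fun D _ χ => AssumptionA D χ →
        ∀ g : ℝ → ℂ, Repair.GluedWallZeroClass K M g → (∀ z, θ ≤ z → g z = 0) → ∀ N : ℕ, ⌈bigP D⌉₊ ≤ N →
          |Repair.discMean c' χ g N - Repair.discMean c' χ g ⌈bigP D⌉₊| ≤
            η * (Repair.discMeanAbs c' χ g ⌈bigP D⌉₊ + frakA χ * frakP D) := by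
  obtain ⟨c₀, h0, h⟩ := partOne_eventually
  exact ⟨c₀, h0, fun c' hc' _ θ K M _ _ hκ hη h𝒞 hB => forAllLarge_of_assumptionA_idx_re_half
    (Repair.discMean_fromWall_topVanishing_of_bandMeanValueOn c' θ K M hκ hη h𝒞 hB
      (Section7cStatements.prop71X_holds c') (h c' hc').2.2.1 prop22i_holds (h c' hc').2.1)⟩

/-- **… specialised to THE SLOT OF RECORD E-004″ `BandMeanValueLip c′ K 1078 κ`** (the band mean-square inequality for
the class's OWN coefficient sequences, `Repair.profCoefClass K`; p479973): bounded lengths, fully closed — ONLY E-004″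
and (A) displayed. [cite: Zhang2022LandauSiegel, §2 (2.16)–(2.20), (2.30)–(2.31); §7 Prop 7.1; §8 Lemma 8.1] -/
theorem discMean_fromWall_of_bandMeanValueLip_closed :
    ∃ c₀ : ℝ, 0 ≤ c₀ ∧ ∀ c' : ℝ, c₀ ≤ c' → ∀ {δ : ℝ}, 0 < δ → ∀ (K : NNReal) (M : ℝ) {κ η : ℝ}, κ < 6 → 0 < η →
      Repair.BandMeanValueLip c' K 1078 κ →
      ForAllLarge fun D _ χ => AssumptionA D χ →
        ∀ g : ℝ → ℂ, Repair.GluedWallZeroClass K M g → ∀ N : ℕ, ⌈bigP D⌉₊ ≤ N → N ≤ ⌈bigP D ^ (1 + δ)⌉₊ →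
          |Repair.discMean c' χ g N - Repair.discMean c' χ g ⌈bigP D⌉₊| ≤
            η * (Repair.discMeanAbs c' χ g ⌈bigP D⌉₊ + frakA χ * frakP D) := by
  obtain ⟨c₀, h0, h⟩ := discMean_fromWall_of_bandMeanValueOn_closed
  exact ⟨c₀, h0, fun c' hc' _ hδ K M _ _ hκ hη hB =>
    h c' hc' (𝒞 := Repair.profCoefClass K) hδ K M hκ hη (fun _ g hg => ⟨g, hg, rfl⟩) hB⟩

/-- **… E-004″, top-vanishing profile, every length, fully closed.**
[cite: Zhang2022LandauSiegel, §2 (2.16)–(2.20), (2.30)–(2.31); §7 Prop 7.1; §8 Lemma 8.1] -/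
theorem discMean_fromWall_topVanishing_of_bandMeanValueLip_closed :
    ∃ c₀ : ℝ, 0 ≤ c₀ ∧ ∀ c' : ℝ, c₀ ≤ c' → ∀ (θ : ℝ) (K : NNReal) (M : ℝ) {κ η : ℝ}, κ < 6 → 0 < η →
      Repair.BandMeanValueLip c' K 1078 κ →
      ForAllLarge fun D _ χ => AssumptionA D χ →
        ∀ g : ℝ → ℂ, Repair.GluedWallZeroClass K M g → (∀ z, θ ≤ z → g z = 0) → ∀ N : ℕ, ⌈bigP D⌉₊ ≤ N →
          |Repair.discMean c' χ g N - Repair.discMean c' χ g ⌈bigP D⌉₊| ≤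
            η * (Repair.discMeanAbs c' χ g ⌈bigP D⌉₊ + frakA χ * frakP D) := by
  obtain ⟨c₀, h0, h⟩ := discMean_fromWall_topVanishing_of_bandMeanValueOn_closed
  exact ⟨c₀, h0, fun c' hc' θ K M _ _ hκ hη hB =>
    h c' hc' (𝒞 := Repair.profCoefClass K) θ K M hκ hη (fun _ g hg => ⟨g, hg, rfl⟩) hB⟩

/-- **Row of record 41′ (`Repair.familyWallZeroBandMVLip`, p480299) read with ONLY E-004″ and (A) displayed:** for every
wall-value-zero design of the class with `c′ ≥ c₀`, every `δ > 0`, `η > 0`, `κ < 6`, GIVEN `BandMeanValueLip c′ 1 1078 κ`: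
for all large `D` under (A) and EVERY `⌈P⌉ ≤ N ≤ ⌈P^{1+δ}⌉`, no main-order movement from the wall —
`¬ (η·(discMeanAbs⌈P⌉ + 𝔞𝔓) < |discMean N − discMean ⌈P⌉|)`.
[cite: Zhang2022LandauSiegel, §2 (2.16)–(2.20), (2.30)–(2.31); §7 Prop 7.1, (7.2) p.44; §8 Lemma 8.1] -/
theorem familyWallZeroBandMVLip_verdict_closed :
    ∃ c₀ : ℝ, 0 ≤ c₀ ∧ ∀ d : Repair.WallZeroDesign, d.InClass → c₀ ≤ d.c' →
      ∀ {δ : ℝ}, 0 < δ → ∀ {η κ : ℝ}, 0 < η → κ < 6 → Repair.BandMeanValueLip d.c' 1 1078 κ →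
        ForAllLarge fun D _ χ => AssumptionA D χ →
          ∀ N : ℕ, ⌈bigP D⌉₊ ≤ N → N ≤ ⌈bigP D ^ (1 + δ)⌉₊ →
            ¬ (η * (Repair.discMeanAbs d.c' χ d.g ⌈bigP D⌉₊ + frakA χ * frakP D) <
                |Repair.discMean d.c' χ d.g N - Repair.discMean d.c' χ d.g ⌈bigP D⌉₊|) := by
  obtain ⟨c₀, h0, h⟩ := discMean_fromWall_of_bandMeanValueLip_closed
  refine ⟨c₀, h0, fun d hd hc' _ hδ _ _ hη hκ hB => ?_⟩
  refine (h d.c' hc' hδ 1 1 hκ hη hB).mono ?_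
  intro D _ χ _ _ hflat hA N hN₁ hN₂
  exact not_lt.2 (hflat hA d.g (Repair.gluedWallZeroClass_of_wallZero d hd) N hN₁ hN₂)

/-- **Row of record 42′ (`Repair.familyWallZeroTopBandMVLip`) read with ONLY E-004″ and (A) displayed:** the FULL
polynomial of a top-vanishing wall-value-zero design, every `N ≥ ⌈P⌉`.
[cite: Zhang2022LandauSiegel, §2 (2.16)–(2.20), (2.30)–(2.31); §7 Prop 7.1, (7.2) p.44; §8 Lemma 8.1] -/
theorem familyWallZeroTopBandMVLip_verdict_closed :
    ∃ c₀ : ℝ, 0 ≤ c₀ ∧ ∀ d : Repair.WallZeroTopDesign, d.InClass → c₀ ≤ d.c' →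
      ∀ {η κ : ℝ}, 0 < η → κ < 6 → Repair.BandMeanValueLip d.c' 1 1078 κ →
        ForAllLarge fun D _ χ => AssumptionA D χ →
          ∀ N : ℕ, ⌈bigP D⌉₊ ≤ N →
            ¬ (η * (Repair.discMeanAbs d.c' χ d.g ⌈bigP D⌉₊ + frakA χ * frakP D) <
                |Repair.discMean d.c' χ d.g N - Repair.discMean d.c' χ d.g ⌈bigP D⌉₊|) := by
  obtain ⟨c₀, h0, h⟩ := discMean_fromWall_topVanishing_of_bandMeanValueLip_closed
  refine ⟨c₀, h0, fun d hd hc' _ _ hη hκ hB => ?_⟩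
  refine (h d.c' hc' d.θ 1 1 hκ hη hB).mono ?_
  intro D _ χ _ _ hflat hA N hN₁
  exact not_lt.2 (hflat hA d.g (Repair.gluedWallZeroClass_of_wallZero d.toWallZeroDesign hd.1) hd.2 N hN₁)

/-- **Row of record 43′ (`Repair.familySmoothWallZeroBandMVLip`: smooth design, any bulk, `K`-Lipschitz `‖·‖ ≤ M`
overhang, wall value zero; slot with the design's own `K`) read with ONLY E-004″ and (A) displayed:** bounded lengths.
[cite: Zhang2022LandauSiegel, §2 (2.16)–(2.20), (2.30)–(2.31); §7 Prop 7.1, (7.2) p.44; §8 Lemma 8.1] -/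
theorem familySmoothWallZeroBandMVLip_verdict_closed :
    ∃ c₀ : ℝ, 0 ≤ c₀ ∧ ∀ d : Repair.SmoothDesign, Repair.familySmoothWallZeroBandMVLip.InClass d → c₀ ≤ d.c' →
      ∀ {δ : ℝ}, 0 < δ → ∀ {η κ : ℝ}, 0 < η → κ < 6 → Repair.BandMeanValueLip d.c' d.K 1078 κ →
        ForAllLarge fun D _ χ => AssumptionA D χ →
          ∀ N : ℕ, ⌈bigP D⌉₊ ≤ N → N ≤ ⌈bigP D ^ (1 + δ)⌉₊ →
            ¬ (η * (Repair.discMeanAbs d.c' χ d.g ⌈bigP D⌉₊ + frakA χ * frakP D) <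
                |Repair.discMean d.c' χ d.g N - Repair.discMean d.c' χ d.g ⌈bigP D⌉₊|) := by
  obtain ⟨c₀, h0, h⟩ := discMean_fromWall_of_bandMeanValueLip_closed
  refine ⟨c₀, h0, fun d hd hc' _ hδ _ _ hη hκ hB => ?_⟩
  refine (h d.c' hc' hδ d.K d.M hκ hη hB).mono ?_
  intro D _ χ _ _ hflat hA N hN₁ hN₂
  exact not_lt.2 (hflat hA d.g ⟨hd.1.1, hd.1.2, hd.2⟩ N hN₁ hN₂)

/-- **Row of record 44′ (`Repair.familySmoothTopWallZeroBandMVLip`: smooth top-vanishing design, wall value zero, full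
polynomial) read with ONLY E-004″ and (A) displayed:** every `N ≥ ⌈P⌉`.
[cite: Zhang2022LandauSiegel, §2 (2.16)–(2.20), (2.30)–(2.31); §7 Prop 7.1, (7.2) p.44; §8 Lemma 8.1] -/
theorem familySmoothTopWallZeroBandMVLip_verdict_closed :
    ∃ c₀ : ℝ, 0 ≤ c₀ ∧ ∀ d : Repair.SmoothTopDesign, Repair.familySmoothTopWallZeroBandMVLip.InClass d → c₀ ≤ d.c' →
      ∀ {η κ : ℝ}, 0 < η → κ < 6 → Repair.BandMeanValueLip d.c' d.K 1078 κ →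
        ForAllLarge fun D _ χ => AssumptionA D χ →
          ∀ N : ℕ, ⌈bigP D⌉₊ ≤ N →
            ¬ (η * (Repair.discMeanAbs d.c' χ d.g ⌈bigP D⌉₊ + frakA χ * frakP D) <
                |Repair.discMean d.c' χ d.g N - Repair.discMean d.c' χ d.g ⌈bigP D⌉₊|) := by
  obtain ⟨c₀, h0, h⟩ := discMean_fromWall_topVanishing_of_bandMeanValueLip_closed
  refine ⟨c₀, h0, fun d hd hc' _ _ hη hκ hB => ?_⟩
  refine (h d.c' hc' d.θ d.K d.M hκ hη hB).mono ?_
  intro D _ χ _ _ hflat hA N hN₁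
  exact not_lt.2 (hflat hA d.g ⟨hd.1.1.1, hd.1.1.2, hd.2⟩ hd.1.2 N hN₁)

/-- The earlier rows 41–44 (slot E-004′ `BandMeanValue`, ALL coefficient sequences; superseded FOR COVERAGE by the rows
of record 41′–44′, REF-E v0.46 — the 01:02:08Z flag «premise model-false» rested on a DESK-MODEL note that its author
WITHDREW at 01:11:22Z, ls-barrier-p2 g3 ERRATUM; the logical relation is unaffected) are the special case
`E-004′ ⇒ E-004″` (`Repair.BandMeanValue.lip`): e.g. row 41 read closed, a true implication either way.
[cite: Zhang2022LandauSiegel, §2 (2.14)–(2.16), (2.30)–(2.31); §7 Prop 7.1; §8 Lemma 8.1] -/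
theorem familyWallZeroBandMV_verdict_closed :
    ∃ c₀ : ℝ, 0 ≤ c₀ ∧ ∀ d : Repair.WallZeroDesign, d.InClass → c₀ ≤ d.c' →
      ∀ {δ : ℝ}, 0 < δ → ∀ {η κ : ℝ}, 0 < η → κ < 6 → Repair.BandMeanValue d.c' 1078 κ →
        ForAllLarge fun D _ χ => AssumptionA D χ →
          ∀ N : ℕ, ⌈bigP D⌉₊ ≤ N → N ≤ ⌈bigP D ^ (1 + δ)⌉₊ →
            ¬ (η * (Repair.discMeanAbs d.c' χ d.g ⌈bigP D⌉₊ + frakA χ * frakP D) <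
                |Repair.discMean d.c' χ d.g N - Repair.discMean d.c' χ d.g ⌈bigP D⌉₊|) := by
  obtain ⟨c₀, h0, h⟩ := familyWallZeroBandMVLip_verdict_closed
  exact ⟨c₀, h0, fun d hd hc' _ hδ _ _ hη hκ hB => h d hd hc' hδ hη hκ (hB.lip 1)⟩

end FromTheWallClosed

/-! ### Part 10 — the FLOOR read closed: the discrete-mean currency of class `R⁺` (`Repair.not_repairable_in_Rplus`,
first §E extension theorem; F-S2 annex `KnifeEdgeDiscMeanFlat.discMeanFlat` p446527 / `discMeanFlat_bv` p457806) and
the far-BV row E-033 (`Repair.familyFarBV`, row of `Rplusplus<k>`) with NO displayed hypothesis at all — their only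
displayed input was the world binder (b), eliminated by `forAllLarge_of_idx_re_half`. Registry row E-003 (E*-inv,
«length-flatness») thereby reads theorem-in-tree OUTRIGHT (eventually in `D`), not «GIVEN (b)». -/

section FloorClosed

/-- **E-003 (E*-inv) with NOTHING displayed** (`discMean_profPoly_flat` / `KnifeEdgeDiscMeanFlat.discMeanFlat`,
p446527, with (b) eliminated): for `0 < ε < δ`, for all large `D` and every real primitive `χ`, for every 1-Lipschitz
profile `g` with `‖g‖ ≤ 1`, the discrete means of its profile polynomials of lengths `⌈P^{1+δ}⌉` and `⌈P^{1+ε}⌉` differ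
by `≤ P^{−ε/8}·(discMeanAbs(short) + discWeight)`. [cite: Zhang2022LandauSiegel, §2 (2.16)–(2.20), Prop. 2.2 (i); §8 Lemma 8.1] -/
theorem discMean_profPoly_flat_closed (c' : ℝ) {δ ε : ℝ} (hε : 0 < ε) (hεδ : ε < δ) :
    ForAllLarge fun D _ χ =>
      ∀ g : ℝ → ℂ, LipschitzWith 1 g → (∀ z, ‖g z‖ ≤ 1) →
        |discMean c' χ (fun x s => profPoly χ x g ⌈bigP D ^ (1 + δ)⌉₊ s) -
            discMean c' χ (fun x s => profPoly χ x g ⌈bigP D ^ (1 + ε)⌉₊ s)| ≤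
          bigP D ^ (-(ε / 8)) *
            (discMeanAbs c' χ (fun x s => profPoly χ x g ⌈bigP D ^ (1 + ε)⌉₊ s) + discWeight c' χ) :=
  forAllLarge_of_idx_re_half (discMean_profPoly_flat c' hε hεδ)

/-- **Class `R⁺`, discrete-mean currency, with NOTHING displayed** (`Repair.not_repairable_in_Rplus_farPiece`, the
`farPiece` case of `Repair.not_repairable_in_Rplus`, with (b) eliminated): on smooth profiles of any length, for all
large `D` and every real primitive `χ`, no main-order gain from pushing the length past `P^{1+ε}`.
[cite: Zhang2022LandauSiegel, §2 (2.16)–(2.20), (2.32)–(2.33), Prop. 2.2 (i); §7 (7.2) p.44; §8 Lemma 8.1] -/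
theorem not_repairable_in_Rplus_farPiece_closed (c' : ℝ) {δ ε : ℝ} {g : ℝ → ℂ} (hε : 0 < ε) (hεδ : ε < δ)
    (hg : LipschitzWith 1 g) (hg1 : ∀ z, ‖g z‖ ≤ 1) :
    ForAllLarge fun D _ χ =>
      ¬ (bigP D ^ (-(ε / 8)) * (Repair.discMeanAbs c' χ g ⌈bigP D ^ (1 + ε)⌉₊ + Repair.discWeight c' χ) <
          |Repair.discMean c' χ g ⌈bigP D ^ (1 + δ)⌉₊ - Repair.discMean c' χ g ⌈bigP D ^ (1 + ε)⌉₊|) :=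
  forAllLarge_of_idx_re_half (Repair.not_repairable_in_Rplus_farPiece c' hε hεδ hg hg1)

/-- **Row `Repair.familyFarPiece` of `R⁺` read with NOTHING displayed.**
[cite: Zhang2022LandauSiegel, §2 (2.16)–(2.20), (2.32)–(2.33), Prop. 2.2 (i); §7 (7.2) p.44] -/
theorem familyFarPiece_verdict_closed (p : ℝ × ℝ × ℝ × (ℝ → ℂ)) (h : Repair.familyFarPiece.InClass p) :
    ForAllLarge fun D _ χ =>
      ¬ (bigP D ^ (-(p.2.2.1 / 8)) *
            (Repair.discMeanAbs p.1 χ p.2.2.2 ⌈bigP D ^ (1 + p.2.2.1)⌉₊ + Repair.discWeight p.1 χ) <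
          |Repair.discMean p.1 χ p.2.2.2 ⌈bigP D ^ (1 + p.2.1)⌉₊ -
            Repair.discMean p.1 χ p.2.2.2 ⌈bigP D ^ (1 + p.2.2.1)⌉₊|) :=
  forAllLarge_of_idx_re_half (Repair.rplus_decided Repair.familyFarPiece (by simp [Repair.Rplus]) p h)

/-- **E-033 / row `Repair.familyFarBV` (far structure of bounded variation, any length) read with NOTHING displayed**
(`Repair.not_lengthGain_farBV` ← `KnifeEdgeDiscMeanFlat.discMeanFlat_bv` p457806, with (b) eliminated): jumps, sharp
cut-offs, steps, PPE blocks beyond the wall gain nothing at main order, for all large `D`, unconditionally.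
[cite: Zhang2022LandauSiegel, §2 (2.16)–(2.20), Prop. 2.2 (i); §7 (7.2); §8 Lemma 8.1] -/
theorem not_lengthGain_farBV_closed (c' : ℝ) {δ ε B V : ℝ} {g : ℝ → ℂ} (hε : 0 < ε) (hεδ : ε < δ) (hB : 0 ≤ B)
    (hV : 0 ≤ V) (hgB : ∀ z, ‖g z‖ ≤ B) (hvar : eVariationOn g (Set.Icc 1 (1 + δ)) ≤ ENNReal.ofReal V) :
    ForAllLarge fun D _ χ =>
      ¬ (bigP D ^ (-(ε / 8)) *
            (Repair.discMeanAbs c' χ g ⌈bigP D ^ (1 + ε)⌉₊ + (B + V) ^ 2 * Repair.discWeight c' χ) <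
          |Repair.discMean c' χ g ⌈bigP D ^ (1 + δ)⌉₊ - Repair.discMean c' χ g ⌈bigP D ^ (1 + ε)⌉₊|) :=
  forAllLarge_of_idx_re_half (Repair.not_lengthGain_farBV c' hε hεδ hB hV hgB hvar)

/-- **Row `Repair.familyFarBV` read with NOTHING displayed.** [cite: Zhang2022LandauSiegel, §2 (2.16)–(2.20); §7 (7.2)] -/
theorem familyFarBV_verdict_closed (d : Repair.FarBVData) (h : Repair.familyFarBV.InClass d) :
    ForAllLarge fun D _ χ =>
      ¬ (bigP D ^ (-(d.ε / 8)) *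
            (Repair.discMeanAbs d.c' χ d.g ⌈bigP D ^ (1 + d.ε)⌉₊ + (d.B + d.V) ^ 2 * Repair.discWeight d.c' χ) <
          |Repair.discMean d.c' χ d.g ⌈bigP D ^ (1 + d.δ)⌉₊ - Repair.discMean d.c' χ d.g ⌈bigP D ^ (1 + d.ε)⌉₊|) :=
  forAllLarge_of_idx_re_half (Repair.familyFarBV_decided d h)

end FloorClosed

/-! ### Part 11 — every remaining TRUE-CURRENCY row of the class of record that displays the world binder (b) inside its
`ForAllLarge`, read WITHOUT (b) (one term each over `forAllLarge_of_idx_re_half`): the wall-zero rows of p459259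
(`familyWallZero`, `familyWallZeroTop`; slot `DiscMeanBandWidthWall0`), the smooth-lengths rows of p457377
(`familySmoothLengths`, `familySmoothTop`; no slot), the main-scale band rows of p466556 (`familyWallZeroMain`,
`familyWallZeroTopMain`; slot `DiscMeanBandMain`), the band-edge rows (`familyBandEdge` p469716, `familySmoothBandEdge` /
`familySmoothTopBandEdge` p470027; no slot), and the true-band rows (`familyWallZeroTrueBand` / `familyWallZeroTopTrueBand`
p470415, slot `DiscMeanTrueBand`; `familySmoothWallZeroTrueBand` / `familySmoothTopWallZeroTrueBand` p471890, slot
`DiscMeanTrueBandKM`). After this Part the residual displayed inputs of these rows are their analytic slots (if any)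
and nothing else; the slot-free rows (smooth lengths, band edge) read with NOTHING displayed. -/

section TrueCurrencyRowsClosed

/-- **Row `Repair.familyWallZero` (wall value zero, from the wall to bounded lengths; slot `DiscMeanBandWidthWall0`)
read without (b).** [cite: Zhang2022LandauSiegel, §2 (2.16)–(2.20), Prop. 2.2 (i); §7 (7.2) p.44; §8 Lemma 8.1] -/
theorem familyWallZero_verdict_closed (d : Repair.WallZeroDesign) (h : d.InClass) :
    ∀ ⦃w δ C : ℝ⦄, 0 < w → w < δ → Repair.DiscMeanBandWidthWall0 d.c' w C →
      ForAllLarge fun D _ χ =>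
        ∀ N : ℕ, ⌈bigP D ^ (1 + w)⌉₊ ≤ N → N ≤ ⌈bigP D ^ (1 + δ)⌉₊ →
          ¬ (C * w * (Repair.discMeanAbs d.c' χ d.g ⌈bigP D⌉₊ + Repair.discWeight d.c' χ) +
                bigP D ^ (-(w / 8)) *
                  (Repair.discMeanAbs d.c' χ d.g ⌈bigP D ^ (1 + w)⌉₊ + Repair.discWeight d.c' χ) <
              |Repair.discMean d.c' χ d.g N - Repair.discMean d.c' χ d.g ⌈bigP D⌉₊|) :=
  fun _ _ _ hw hwδ hs => forAllLarge_of_idx_re_half (Repair.WallZeroDesign.verdict_of_inClass d h hw hwδ hs)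

/-- **Row `Repair.familyWallZeroTop` (top-vanishing, full polynomial; slot `DiscMeanBandWidthWall0`) read without (b).**
[cite: Zhang2022LandauSiegel, §2 (2.16)–(2.20), Prop. 2.2 (i); §7 (7.2) p.44; §8 Lemma 8.1] -/
theorem familyWallZeroTop_verdict_closed (d : Repair.WallZeroTopDesign) (h : d.InClass) :
    ∀ ⦃w C : ℝ⦄, 0 < w → Repair.DiscMeanBandWidthWall0 d.c' w C →
      ForAllLarge fun D _ χ =>
        ∀ N : ℕ, ⌈bigP D ^ (1 + w)⌉₊ ≤ N →
          ¬ (C * w * (Repair.discMeanAbs d.c' χ d.g ⌈bigP D⌉₊ + Repair.discWeight d.c' χ) +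
                bigP D ^ (-(w / 8)) *
                  (Repair.discMeanAbs d.c' χ d.g ⌈bigP D ^ (1 + w)⌉₊ + Repair.discWeight d.c' χ) <
              |Repair.discMean d.c' χ d.g N - Repair.discMean d.c' χ d.g ⌈bigP D⌉₊|) :=
  fun _ _ hw hs => forAllLarge_of_idx_re_half (Repair.WallZeroTopDesign.verdict_of_inClass d h hw hs)

/-- **Row `Repair.familySmoothLengths` (smooth overhang, any two lengths beyond `P^{1+ε}`; NO slot) read with NOTHING
displayed.** [cite: Zhang2022LandauSiegel, §2 (2.16)–(2.20), Prop. 2.2 (i); §7 (7.2) p.44; §8 Lemma 8.1] -/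
theorem familySmoothLengths_verdict_closed (d : Repair.SmoothDesign) (h : d.InClass) :
    ∀ ⦃δ ε : ℝ⦄, 0 < ε → ε < δ → ForAllLarge fun D _ χ =>
      ∀ N₁ N₂ : ℕ, ⌈bigP D ^ (1 + ε)⌉₊ ≤ N₁ → N₁ ≤ N₂ → N₂ ≤ ⌈bigP D ^ (1 + δ)⌉₊ →
        ¬ (bigP D ^ (-(ε / 8)) *
              (Repair.discMeanAbs d.c' χ d.g N₁ + max (d.K : ℝ) d.M ^ 2 * Repair.discWeight d.c' χ) <
            |Repair.discMean d.c' χ d.g N₂ - Repair.discMean d.c' χ d.g N₁|) :=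
  fun _ _ hε hεδ => forAllLarge_of_idx_re_half (Repair.SmoothDesign.verdict_of_inClass d h hε hεδ)

/-- **Row `Repair.familySmoothTop` (smooth top-vanishing piece of any length; NO slot) read with NOTHING displayed.**
[cite: Zhang2022LandauSiegel, §2 (2.16)–(2.20), Prop. 2.2 (i); §7 (7.2) p.44; §8 Lemma 8.1] -/
theorem familySmoothTop_verdict_closed (d : Repair.SmoothTopDesign) (h : d.InClass) :
    ∀ ⦃ε : ℝ⦄, 0 < ε → ForAllLarge fun D _ χ =>
      ∀ N : ℕ, ⌈bigP D ^ (1 + ε)⌉₊ ≤ N →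
        ¬ (bigP D ^ (-(ε / 8)) *
              (Repair.discMeanAbs d.c' χ d.g ⌈bigP D ^ (1 + ε)⌉₊ + max (d.K : ℝ) d.M ^ 2 * Repair.discWeight d.c' χ) <
            |Repair.discMean d.c' χ d.g N - Repair.discMean d.c' χ d.g ⌈bigP D ^ (1 + ε)⌉₊|) :=
  fun _ hε => forAllLarge_of_idx_re_half (Repair.SmoothTopDesign.verdict_of_inClass d h hε)

/-- **Row `Repair.familyWallZeroMain` (main-scale band slot `DiscMeanBandMain`, bounded lengths) read without (b).**
[cite: Zhang2022LandauSiegel, §2 (2.16)–(2.20), (2.30)–(2.31), Prop. 2.2 (i); §7 (7.2) p.44; §8 Lemma 8.1] -/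
theorem familyWallZeroMain_verdict_closed (d : Repair.WallZeroDesign) (h : d.InClass) :
    ∀ ⦃w δ η : ℝ⦄, 0 < w → w < δ → Repair.DiscMeanBandMain d.c' w η →
      ForAllLarge fun D _ χ =>
        ∀ N : ℕ, ⌈bigP D ^ (1 + w)⌉₊ ≤ N → N ≤ ⌈bigP D ^ (1 + δ)⌉₊ →
          ¬ (η * (Repair.discMeanAbs d.c' χ d.g ⌈bigP D⌉₊ + frakA χ * frakP D) +
                bigP D ^ (-(w / 8)) *
                  (Repair.discMeanAbs d.c' χ d.g ⌈bigP D ^ (1 + w)⌉₊ + Repair.discWeight d.c' χ) <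
              |Repair.discMean d.c' χ d.g N - Repair.discMean d.c' χ d.g ⌈bigP D⌉₊|) :=
  fun _ _ _ hw hwδ hs => forAllLarge_of_idx_re_half (Repair.WallZeroDesign.verdictMain_of_inClass d h hw hwδ hs)

/-- **Row `Repair.familyWallZeroTopMain` (main-scale band slot, top-vanishing, full polynomial) read without (b).**
[cite: Zhang2022LandauSiegel, §2 (2.16)–(2.20), (2.30)–(2.31), Prop. 2.2 (i); §7 (7.2) p.44; §8 Lemma 8.1] -/
theorem familyWallZeroTopMain_verdict_closed (d : Repair.WallZeroTopDesign) (h : d.InClass) :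
    ∀ ⦃w η : ℝ⦄, 0 < w → Repair.DiscMeanBandMain d.c' w η →
      ForAllLarge fun D _ χ =>
        ∀ N : ℕ, ⌈bigP D ^ (1 + w)⌉₊ ≤ N →
          ¬ (η * (Repair.discMeanAbs d.c' χ d.g ⌈bigP D⌉₊ + frakA χ * frakP D) +
                bigP D ^ (-(w / 8)) *
                  (Repair.discMeanAbs d.c' χ d.g ⌈bigP D ^ (1 + w)⌉₊ + Repair.discWeight d.c' χ) <
              |Repair.discMean d.c' χ d.g N - Repair.discMean d.c' χ d.g ⌈bigP D⌉₊|) :=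
  fun _ _ hw hs => forAllLarge_of_idx_re_half (Repair.WallZeroTopDesign.verdictMain_of_inClass d h hw hs)

/-- **Row `Repair.familyBandEdge` (any 1-Lipschitz profile, any two lengths beyond the true band edge; NO slot) read with
NOTHING displayed.** [cite: Zhang2022LandauSiegel, §2 (2.16)–(2.20), (2.30), Prop. 2.2 (i); §7 (7.2) p.44; §8 Lemma 8.1] -/
theorem familyBandEdge_verdict_closed (d : Repair.BandEdgeDesign) (h : d.InClass) :
    ∀ ⦃δ : ℝ⦄, 0 < δ → ∀ A : ℕ, ForAllLarge fun D _ χ =>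
      ∀ N₁ N₂ : ℕ, ⌈(D : ℝ) * bigP D * ell D ^ (1058 + 2 * A)⌉₊ + 1 ≤ N₁ → N₁ ≤ N₂ →
        N₂ ≤ ⌈bigP D ^ (1 + δ)⌉₊ →
        ¬ ((ell D ^ A)⁻¹ * (Repair.discMeanAbs d.c' χ d.g N₁ + Repair.discWeight d.c' χ) <
            |Repair.discMean d.c' χ d.g N₂ - Repair.discMean d.c' χ d.g N₁|) :=
  fun _ hδ A => forAllLarge_of_idx_re_half (Repair.BandEdgeDesign.verdict_of_inClass d h hδ A)

/-- **Row `Repair.familySmoothBandEdge` (smooth design, any two lengths beyond the true band edge; NO slot) read with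
NOTHING displayed.** [cite: Zhang2022LandauSiegel, §2 (2.16)–(2.20), (2.30), Prop. 2.2 (i); §7 (7.2) p.44; §8 Lemma 8.1] -/
theorem familySmoothBandEdge_verdict_closed (d : Repair.SmoothDesign) (h : d.InClass) :
    ∀ ⦃δ : ℝ⦄, 0 < δ → ∀ A : ℕ, ForAllLarge fun D _ χ =>
      ∀ N₁ N₂ : ℕ, ⌈(D : ℝ) * bigP D * ell D ^ (1058 + 2 * A)⌉₊ + 1 ≤ N₁ → N₁ ≤ N₂ →
        N₂ ≤ ⌈bigP D ^ (1 + δ)⌉₊ →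
        ¬ ((ell D ^ A)⁻¹ * (Repair.discMeanAbs d.c' χ d.g N₁ + max (d.K : ℝ) d.M ^ 2 * Repair.discWeight d.c' χ) <
            |Repair.discMean d.c' χ d.g N₂ - Repair.discMean d.c' χ d.g N₁|) :=
  fun _ hδ A => forAllLarge_of_idx_re_half (Repair.SmoothDesign.verdictBandEdge_of_inClass d h hδ A)

/-- **Row `Repair.familySmoothTopBandEdge` (smooth top-vanishing design beyond the true band edge; NO slot) read with
NOTHING displayed.** [cite: Zhang2022LandauSiegel, §2 (2.16)–(2.20), (2.30), Prop. 2.2 (i); §7 (7.2) p.44; §8 Lemma 8.1] -/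
theorem familySmoothTopBandEdge_verdict_closed (d : Repair.SmoothTopDesign) (h : d.InClass) :
    ∀ A : ℕ, ForAllLarge fun D _ χ =>
      ∀ N₁ N₂ : ℕ, ⌈(D : ℝ) * bigP D * ell D ^ (1058 + 2 * A)⌉₊ + 1 ≤ N₁ →
        N₁ ≤ ⌈bigP D ^ (1 + (|d.θ - 1| + 1))⌉₊ → N₁ ≤ N₂ →
        ¬ ((ell D ^ A)⁻¹ * (Repair.discMeanAbs d.c' χ d.g N₁ + max (d.K : ℝ) d.M ^ 2 * Repair.discWeight d.c' χ) <
            |Repair.discMean d.c' χ d.g N₂ - Repair.discMean d.c' χ d.g N₁|) :=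
  fun A => forAllLarge_of_idx_re_half (Repair.SmoothTopDesign.verdictBandEdge_of_inClass d h A)

/-- **Row `Repair.familyWallZeroTrueBand` (E-004 true-band slot `DiscMeanTrueBand`, bounded lengths) read without (b):**
ONLY the slot displayed. [cite: Zhang2022LandauSiegel, §2 (2.16)–(2.20), (2.30)–(2.31), Prop. 2.2 (i); §7 (7.2) p.44; §8 Lemma 8.1] -/
theorem familyWallZeroTrueBand_verdict_closed (d : Repair.WallZeroDesign) (h : d.InClass) :
    ∀ ⦃δ : ℝ⦄, 0 < δ → ∀ (A : ℕ) (η : ℝ), Repair.DiscMeanTrueBand d.c' (1058 + 2 * A) η →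
      ForAllLarge fun D _ χ =>
        ∀ N : ℕ, ⌈bigP D⌉₊ ≤ N → N ≤ ⌈bigP D ^ (1 + δ)⌉₊ →
          ¬ (η * (Repair.discMeanAbs d.c' χ d.g ⌈bigP D⌉₊ + frakA χ * frakP D) +
                (ell D ^ A)⁻¹ *
                  (Repair.discMeanAbs d.c' χ d.g (Repair.bandEdge D (1058 + 2 * A)) + Repair.discWeight d.c' χ) <
              |Repair.discMean d.c' χ d.g N - Repair.discMean d.c' χ d.g ⌈bigP D⌉₊|) :=
  fun _ hδ A η hs => forAllLarge_of_idx_re_half (Repair.WallZeroDesign.verdictTrueBand_of_inClass d h hδ A η hs)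

/-- **Row `Repair.familyWallZeroTopTrueBand` (true-band slot, top-vanishing, full polynomial) read without (b).**
[cite: Zhang2022LandauSiegel, §2 (2.16)–(2.20), (2.30)–(2.31), Prop. 2.2 (i); §7 (7.2) p.44; §8 Lemma 8.1] -/
theorem familyWallZeroTopTrueBand_verdict_closed (d : Repair.WallZeroTopDesign) (h : d.InClass) :
    ∀ (A : ℕ) (η : ℝ), Repair.DiscMeanTrueBand d.c' (1058 + 2 * A) η →
      ForAllLarge fun D _ χ =>
        ∀ N : ℕ, ⌈bigP D⌉₊ ≤ N →
          ¬ (η * (Repair.discMeanAbs d.c' χ d.g ⌈bigP D⌉₊ + frakA χ * frakP D) +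
                (ell D ^ A)⁻¹ *
                  (Repair.discMeanAbs d.c' χ d.g (Repair.bandEdge D (1058 + 2 * A)) + Repair.discWeight d.c' χ) <
              |Repair.discMean d.c' χ d.g N - Repair.discMean d.c' χ d.g ⌈bigP D⌉₊|) :=
  fun A η hs => forAllLarge_of_idx_re_half (Repair.WallZeroTopDesign.verdictTrueBand_of_inClass d h A η hs)

/-- **Row `Repair.familySmoothWallZeroTrueBand` (glued class `(K, M)`, wall value zero; slot `DiscMeanTrueBandKM`) read
without (b).** [cite: Zhang2022LandauSiegel, §2 (2.16)–(2.20), (2.30)–(2.31), Prop. 2.2 (i); §7 (7.2) p.44; §8 Lemma 8.1] -/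
theorem familySmoothWallZeroTrueBand_verdict_closed (d : Repair.SmoothDesign)
    (h : Repair.familySmoothWallZeroTrueBand.InClass d) :
    ∀ ⦃δ : ℝ⦄, 0 < δ → ∀ (A : ℕ) (η : ℝ), Repair.DiscMeanTrueBandKM d.c' d.K d.M (1058 + 2 * A) η →
      ForAllLarge fun D _ χ =>
        ∀ N : ℕ, ⌈bigP D⌉₊ ≤ N → N ≤ ⌈bigP D ^ (1 + δ)⌉₊ →
          ¬ (η * (Repair.discMeanAbs d.c' χ d.g ⌈bigP D⌉₊ + frakA χ * frakP D) +
                (ell D ^ A)⁻¹ *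
                  (Repair.discMeanAbs d.c' χ d.g (Repair.bandEdge D (1058 + 2 * A)) +
                    max (d.K : ℝ) d.M ^ 2 * Repair.discWeight d.c' χ) <
              |Repair.discMean d.c' χ d.g N - Repair.discMean d.c' χ d.g ⌈bigP D⌉₊|) :=
  fun _ hδ A η hs => forAllLarge_of_idx_re_half
    (Repair.SmoothDesign.verdictTrueBand_of_inClassWall0 d h.1 h.2 hδ A η hs)

/-- **Row `Repair.familySmoothTopWallZeroTrueBand` (glued class, top-vanishing, full polynomial; slot `DiscMeanTrueBandKM`)
read without (b).** [cite: Zhang2022LandauSiegel, §2 (2.16)–(2.20), (2.30)–(2.31), Prop. 2.2 (i); §7 (7.2) p.44; §8 Lemma 8.1] -/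
theorem familySmoothTopWallZeroTrueBand_verdict_closed (d : Repair.SmoothTopDesign)
    (h : Repair.familySmoothTopWallZeroTrueBand.InClass d) :
    ∀ (A : ℕ) (η : ℝ), Repair.DiscMeanTrueBandKM d.c' d.K d.M (1058 + 2 * A) η →
      ForAllLarge fun D _ χ =>
        ∀ N : ℕ, ⌈bigP D⌉₊ ≤ N →
          ¬ (η * (Repair.discMeanAbs d.c' χ d.g ⌈bigP D⌉₊ + frakA χ * frakP D) +
                (ell D ^ A)⁻¹ *
                  (Repair.discMeanAbs d.c' χ d.g (Repair.bandEdge D (1058 + 2 * A)) +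
                    max (d.K : ℝ) d.M ^ 2 * Repair.discWeight d.c' χ) <
              |Repair.discMean d.c' χ d.g N - Repair.discMean d.c' χ d.g ⌈bigP D⌉₊|) :=
  fun A η hs => forAllLarge_of_idx_re_half
    (Repair.SmoothTopDesign.verdictTrueBand_of_inClassWall0 d h.1 h.2 A η hs)

end TrueCurrencyRowsClosed

/-! ### Part 12 — (B1) POSITIVITY AND `GramPSD_k` WITH NOTHING DISPLAYED (eventual reading): the structural positivity
of the method (LEVERS §0.6 (B1): weights `Re 𝔠*·Re ω ≥ 0`, hence every discrete mean `≥ 0` and every Gram matrix of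
value tables PSD), on which every KILL word and every row of the class of record rests, is a tree theorem for every
`c′ ≥ c₀` and all large `D` — no Lemma 2.3 / Prop. 2.2 (i) binder displayed (`weights_nonneg_eventually`, Part 9).
The discrete Gram family `familyGramTables` (`RepairGramBlock`, verdict displayed «GIVEN (w)» at every modulus) thereby
reads, eventually in `D`, with NOTHING displayed. -/

section PositivityClosed

/-- **(B1) with nothing displayed:** for every sufficiently large `c′`, for all large `D` and every real primitive `χ`,
EVERY value table has discrete mean `≥ 0`. [cite: Zhang2022LandauSiegel, §2 Lemma 2.3, Prop. 2.2 (i), (2.15)–(2.17)] -/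
theorem discMean_nonneg_eventually :
    ∃ c₀ : ℝ, 0 ≤ c₀ ∧ ∀ c' : ℝ, c₀ ≤ c' →
      ForAllLarge fun D _ χ => ∀ F : Chr D → ℂ → ℂ, 0 ≤ discMean c' χ F := by
  obtain ⟨c₀, h0, h⟩ := weights_nonneg_eventually
  exact ⟨c₀, h0, fun c' hc' => (h c' hc').mono fun _ _ _ _ _ hw F => discMean_nonneg hw F⟩

/-- **`GramPSD_k` with nothing displayed** (`discGram_posSemidef`, p460485, with (w) eliminated): for every sufficiently
large `c′`, for all large `D` and every real primitive `χ`, the Gram matrix of ANY finite family of value tables is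
positive semidefinite. [cite: Zhang2022LandauSiegel, §2 Lemma 2.3, Prop. 2.2 (i), (2.15)–(2.17)] -/
theorem discGram_posSemidef_eventually {ι : Type*} [Fintype ι] :
    ∃ c₀ : ℝ, 0 ≤ c₀ ∧ ∀ c' : ℝ, c₀ ≤ c' →
      ForAllLarge fun D _ χ => ∀ H : ι → (Chr D → ℂ → ℂ), (discGram c' χ H).PosSemidef := by
  obtain ⟨c₀, h0, h⟩ := weights_nonneg_eventually
  exact ⟨c₀, h0, fun c' hc' => (h c' hc').mono fun _ _ _ _ _ hw H => discGram_posSemidef hw H⟩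

/-- **Member corollary with nothing displayed:** for every sufficiently large `c′`, for all large `D`, every finite
table combination `Σ xᵢHᵢ` has `Re(x G x†) ≥ 0`. [cite: Zhang2022LandauSiegel, §2 Lemma 2.3, Prop. 2.2 (i), (2.15)–(2.17)] -/
theorem discMean_tableComb_nonneg_eventually {ι : Type*} [Fintype ι] :
    ∃ c₀ : ℝ, 0 ≤ c₀ ∧ ∀ c' : ℝ, c₀ ≤ c' →
      ForAllLarge fun D _ χ => ∀ (x : ι → ℂ) (H : ι → (Chr D → ℂ → ℂ)),
        0 ≤ (∑ i, ∑ j, x i * conj (x j) * discPolar c' χ (H i) (H j)).re := by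
  obtain ⟨c₀, h0, h⟩ := weights_nonneg_eventually
  exact ⟨c₀, h0, fun c' hc' => (h c' hc').mono fun _ _ _ _ _ hw x H => discMean_tableComb_nonneg hw x H⟩

/-- **Row `Repair.familyGramTables` (E-19 books: every finite family of value tables, discrete-mean currency; verdict
displayed «GIVEN (w)» at every modulus) read, for `c′ ≥ c₀` and all large `D`, with NOTHING displayed:** no amplitude
vector has a negative discrete mean. [cite: Zhang2022LandauSiegel, §2 (2.16)–(2.17), Lemma 2.3, Prop. 2.2 (i)] -/
theorem familyGramTables_verdict_eventually :
    ∃ c₀ : ℝ, 0 ≤ c₀ ∧ ∀ c' : ℝ, c₀ ≤ c' →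
      ForAllLarge fun D _ χ =>
        ∀ d : Σ k : ℕ, (Fin k → ℂ) × (Fin k → ((D : ℕ) → DirichletCharacter ℂ D → (Chr D → ℂ → ℂ))),
          ¬ (discMean c' χ (tableComb d.2.1 fun i => d.2.2 i D χ) < 0) := by
  obtain ⟨c₀, h0, h⟩ := discMean_nonneg_eventually
  exact ⟨c₀, h0, fun c' hc' => (h c' hc').mono fun _ _ _ _ _ hpos d => not_lt.2 (hpos _)⟩

end PositivityClosed

end KnifeEdge

end Literature.NumberTheory.LFunctions.Zhang2022
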